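import Literature.Topology.FourManifolds.PLUniquenessCoords
import Literature.Topology.FourManifolds.PLUniquenessGlue
import Literature.Topology.FourManifolds.WhiteheadBendMap
import HarnessLib

/-!
# Uniqueness of Whitehead-compatible PL structures: one stage

Towards `Literature.Topology.FourManifolds.nonempty_plHomeomorph_of_isWhiteheadCompatible`
(Munkres (1966), Thm 10.5).  One stage of the uniqueness induction: the two sheets of
`PLUniquenessSheets`/`PLUniquenessCoords` are bent **in lockstep** by two instances of the
bending step `WhiteheadBend`/`WhiteheadBendMap` sharing the chart `ψ`, the levels, the cut-off and
the fineness; since the lattice refinement is canonical in the common coordinate space and the two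
sheet maps agree on the shared coordinate simplices, the two bent maps — and the two comparison
homeomorphisms `Ψ_K`, `Ψ_L` of `M` — agree near the protected PL region.  The new homeomorphisms
`F' = Ψ_K ∘ F`, `G' = Ψ_L ∘ G` are again PD along the two PL structures, `F'⁻¹ ∘ G'` is still PL
where it was (up to the prescribed collar) and has become PL over the new ball, where both bent
sheets are straight in `ψ`.

No named facts are introduced.

## References

* J.R. Munkres, *Elementary differential topology*, Ann. of Math. Studies 54 (1963; rev. 1966),
  §10, 10.2–10.5. [Munkres1966]
-/

open Set Function Metric Filter
open scoped Topology ContDiff Manifold NNReal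

noncomputable section

namespace Literature.Topology.FourManifolds

open Literature.Analysis.Convexity Literature.Analysis.Convexity.SignArrangement

local notation "𝔼 " n:arg => EuclideanSpace ℝ (Fin n)

/-! ### Lattice refinements of two coordinate complexes agree on common faces -/

section Lattice

variable {N : ℕ}

/-- **A simplex of the lattice refinement of `K` whose vertices lie in the underlying space of the
coordinate complex `K'` is a simplex of the lattice refinement of `K'`** (same ambient `ℝᴺ`, same
fineness): the lattice arrangement and the chosen points do not depend on the complex, only the
admissible faces do, and a face whose chosen point lies in `K'.space` lies in `K'.space`.
[folklore] -/
theorem mem_latticeRefinement_of_subset {K K' : Geometry.SimplicialComplex ℝ (Fin N → ℝ)}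
    (hK' : IsCoordinate K') {m : ℕ} {hm : 0 < m} {t : Finset (Fin N → ℝ)}
    (ht : t ∈ (latticeRefinement K m hm).faces) (htK' : (t : Set (Fin N → ℝ)) ⊆ K'.space) :
    t ∈ (latticeRefinement K' m hm).faces := by
  classical
  obtain ⟨C, hCΦ, hCne, hC, rfl⟩ := ht
  refine ⟨C, fun ε hε => ?_, hCne, hC, rfl⟩
  have hεK : ε ∈ latticePhi K m := hCΦ hε
  obtain ⟨hne, -⟩ := mem_latticePhi.1 hεK
  have hb : latticeB m ε ∈ face (latticeFun m) ε := latticeB_mem hm ε hεK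
  have hbK' : latticeB m ε ∈ K'.space := htK' (Finset.mem_coe.2 (Finset.mem_image_of_mem _ hε))
  refine mem_latticePhi.2 ⟨hne, ?_⟩
  rw [← show svec (latticeFun m) (latticeB m ε) = ε from hb]
  refine (face_subset_cl.trans (cl_svec_subset_stdFace hm (I := {i | latticeB m ε i ≠ 0}) ?_)).trans
    (hK'.stdFace_subset_space hbK')
  have h := hK'.space_subset_stdFace hbK'
  exact ⟨h.1, h.2.1, fun i hi => by simpa using hi⟩

/-- **Secant maps of two coordinate complexes agree on a common face** when the two maps agree
there (same fineness): for `s ∈ K.faces ∩ K'.faces` and `g = g'` on `conv s`,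
`plMap (latticeRefinement K m) g = plMap (latticeRefinement K' m) g'` on `conv s`.
[cite: Munkres1966, 9.1 and 10.2] -/
theorem plMap_latticeRefinement_eqOn {W : Type*} [NormedAddCommGroup W] [NormedSpace ℝ W]
    {K K' : Geometry.SimplicialComplex ℝ (Fin N → ℝ)} (hK : IsCoordinate K) (hK' : IsCoordinate K')
    {m : ℕ} {hm : 0 < m} {s : Finset (Fin N → ℝ)} (hs : s ∈ K.faces) (hs' : s ∈ K'.faces)
    {g g' : (Fin N → ℝ) → W} (hgg' : EqOn g g' (convexHull ℝ (s : Set (Fin N → ℝ)))) :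
    EqOn (plMap (latticeRefinement K m hm) g) (plMap (latticeRefinement K' m hm) g')
      (convexHull ℝ (s : Set (Fin N → ℝ))) := by
  classical
  intro x hx
  obtain ⟨t, ht, hxt, hts⟩ := exists_mem_latticeRefinement_of_mem hK hs hx
  have ht' : t ∈ (latticeRefinement K' m hm).faces :=
    mem_latticeRefinement_of_subset hK' ht ((subset_convexHull ℝ _).trans
      (hts.trans (K'.convexHull_subset_space hs')))
  obtain ⟨A, hA, hAv⟩ := exists_affineMap_eqOn_plMap (K := latticeRefinement K m hm) (g := g) ht
  obtain ⟨A', hA', hA'v⟩ := exists_affineMap_eqOn_plMap (K := latticeRefinement K' m hm) (g := g') ht'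
  rw [hA hxt, hA' hxt]
  exact affine_eqOn_convexHull_of_forall_eq (fun v hv => by
    rw [hAv v hv, hA'v v hv, hgg' (hts (subset_convexHull ℝ _ hv))]) hxt

end Lattice

/-! ### PL maps from simplexwise affine pieces -/

section PLPieces

variable {n : ℕ}

/-- **A map with affine pieces on a finite complex is PL on the interior of its underlying
space.** [folklore] -/
theorem isPLOn_of_affine_pieces {K : Geometry.SimplicialComplex ℝ (𝔼 n)} (hfin : K.faces.Finite)
    {φ : 𝔼 n → 𝔼 n} (hφ : ∀ s ∈ K.faces, AffModel φ s) : IsPLOn n n φ (interior K.space) := by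
  classical
  intro a ha
  obtain ⟨D, hDind, -, hDa, hDsub⟩ := exists_affineIndependent_convexHull_subset
    (interior_mem_nhds.2 (mem_interior_iff_mem_nhds.1 ha))
  set S : Finset (Finset (𝔼 n)) := insert D hfin.toFinset with hS
  have hmemS : ∀ s, s ∈ S ↔ s = D ∨ s ∈ K.faces := fun s => by
    rw [hS, Finset.mem_insert, Set.Finite.mem_toFinset]
  have hSind : ∀ s ∈ S, AffineIndependent ℝ ((↑) : s → 𝔼 n) := fun s hs => by
    rcases (hmemS s).1 hs with rfl | h
    · exact hDind
    · exact K.indep h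
  obtain ⟨P, hPfin, hPspace, -, hPvert⟩ := exists_cellTriangulation S hSind {D}
    (Finset.singleton_subset_iff.2 ((hmemS D).2 (Or.inl rfl))) (fun _ : Fin 0 => (0 : 𝔼 n →ᵃ[ℝ] ℝ))
  have hspace : P.space = convexHull ℝ (D : Set (𝔼 n)) := by rw [hPspace]; simp
  refine ⟨P, hPfin, by rw [hspace]; exact hDa, by rw [hspace]; exact hDsub, fun t ht => ?_⟩
  obtain ⟨x, hxt, ⟨D', hD', htD'⟩, hxS, -⟩ := hPvert t ht
  rw [Finset.mem_singleton] at hD'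
  subst hD'
  have hxK : x ∈ K.space := interior_subset (hDsub (htD' (subset_convexHull ℝ _ hxt)))
  obtain ⟨u, hu, hxu⟩ := Geometry.SimplicialComplex.mem_space_iff.1 hxK
  exact ((hφ u hu).anti (hxS u ((hmemS u).2 (Or.inr hu)) hxu)).out

/-- **The inverse of an injective map with affine pieces on a finite complex is PL on the interior
of the image.** [folklore] -/
theorem isPLOn_invFunOn_of_affine_pieces {K : Geometry.SimplicialComplex ℝ (𝔼 n)}
    (hfin : K.faces.Finite) {φ : 𝔼 n → 𝔼 n} (hφ : ∀ s ∈ K.faces, AffModel φ s)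
    (hinj : InjOn φ K.space) : IsPLOn n n (invFunOn φ K.space) (interior (φ '' K.space)) := by
  classical
  obtain ⟨K', hK'faces, hK'hull⟩ := exists_simplicialComplex_image K φ (fun s hs => (hφ s hs).out) hinj
  have hK'fin : K'.faces.Finite := by
    have : K'.faces = (fun s => s.image φ) '' K.faces := by
      ext t; rw [hK'faces t, Set.mem_image]
    rw [this]; exact hfin.image _
  have hK'space : K'.space = φ '' K.space := by
    refine Subset.antisymm (fun z hz => ?_) ?_
    · obtain ⟨t, ht, hzt⟩ := Geometry.SimplicialComplex.mem_space_iff.1 hz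
      obtain ⟨s, hs, rfl⟩ := (hK'faces t).1 ht
      rw [hK'hull s hs] at hzt
      exact image_mono (K.convexHull_subset_space hs) hzt
    · rintro _ ⟨y, hy, rfl⟩
      obtain ⟨s, hs, hys⟩ := Geometry.SimplicialComplex.mem_space_iff.1 hy
      refine Geometry.SimplicialComplex.mem_space_iff.2 ⟨s.image φ, (hK'faces _).2 ⟨s, hs, rfl⟩, ?_⟩
      rw [hK'hull s hs]; exact ⟨y, hys, rfl⟩
  rw [← hK'space]
  refine isPLOn_of_affine_pieces hK'fin fun t ht => ?_
  obtain ⟨s, hs, rfl⟩ := (hK'faces t).1 ht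
  obtain ⟨A, hA⟩ := (hφ s hs).out
  have hAinj : InjOn A (convexHull ℝ (s : Set (𝔼 n))) := fun y hy y' hy' h =>
    hinj (K.convexHull_subset_space hs hy) (K.convexHull_subset_space hs hy')
      (by rw [hA hy, hA hy']; exact h)
  obtain ⟨B, hB⟩ := exists_affine_leftInv A hAinj
  refine ⟨⟨B, fun z hz => ?_⟩⟩
  rw [hK'hull s hs] at hz
  obtain ⟨y, hy, rfl⟩ := hz
  rw [hinj.leftInvOn_invFunOn (K.convexHull_subset_space hs hy), hA hy, hB y hy]

end PLPieces

/-! ### `PLAlongOn` under local modifications -/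

section Along

variable {n : ℕ} {M : Type*} [TopologicalSpace M]

/-- **`PLAlongOn` only sees the map on the set**: if `h' = h` on the open set `U` and `W` is
open, then `PLAlongOn … h W` gives `PLAlongOn … h' (W ∩ U)`. [folklore] -/
theorem PLAlongOn.congr_inter {c c' : ChartedSpace (𝔼 n) M} {h h' : M ≃ₜ M} {W U : Set M}
    (hW : PLAlongOn n c c' h W) (hWo : IsOpen W) (hU : IsOpen U) (heq : ∀ p ∈ U, h' p = h p) :
    PLAlongOn n c c' h' (W ∩ U) := by
  refine ⟨fun e he e' he' => IsPLOn.of_forall_exists fun x hx => ?_⟩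
  obtain ⟨hxt, ⟨hxW, hxU⟩, hxe'⟩ := hx
  set v : Set (𝔼 n) := e.target ∩ e.symm ⁻¹' (W ∩ U ∩ h ⁻¹' e'.source) with hv
  have hvo : IsOpen v := by
    have h1 := e.symm.isOpen_inter_preimage
      ((hWo.inter hU).inter (e'.open_source.preimage h.continuous))
    rwa [e.symm_source] at h1
  have hvu : v ⊆ e.target ∩ e.symm ⁻¹' (W ∩ h ⁻¹' e'.source) := fun y hy =>
    ⟨hy.1, hy.2.1.1, hy.2.2⟩
  have h1 : IsPLOn n n (e' ∘ h ∘ e.symm) v := IsPLOn.mono_holds (hW.isPLOn e he e' he') hvo hvu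
  have h2 : IsPLOn n n (e' ∘ h' ∘ e.symm) v :=
    h1.congr hvo fun y hy => by
      show e' (h' (e.symm y)) = e' (h (e.symm y))
      rw [heq _ hy.2.1.2]
  refine ⟨v, fun y hy => ⟨hy.1, hy.2.1, ?_⟩, ⟨hxt, ⟨hxW, hxU⟩, ?_⟩, h2⟩
  · show h' (e.symm y) ∈ e'.source
    rw [heq _ hy.2.1.2]; exact hy.2.2
  · show h (e.symm x) ∈ e'.source
    rw [← heq _ hxU]; exact hxe'

/-- `PLAlongOn` on a union of two sets. [folklore] -/
theorem plAlongOn_union {c c' : ChartedSpace (𝔼 n) M} {h : M ≃ₜ M} {W₁ W₂ : Set M}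
    (h₁ : PLAlongOn n c c' h W₁) (h₂ : PLAlongOn n c c' h W₂) : PLAlongOn n c c' h (W₁ ∪ W₂) := by
  rw [union_eq_iUnion]
  exact plAlongOn_iUnion fun b => by cases b <;> assumption

/-- `PLAlongOn` for a preimage set: `h` PL along `(c, c')` over `W` gives, for an open `A` with
`W ⊇ A`, the same over `A`. (Convenience form of `anti`.) [folklore] -/
theorem PLAlongOn.anti' {c c' : ChartedSpace (𝔼 n) M} {h : M ≃ₜ M} {W W' : Set M}
    (hW : PLAlongOn n c c' h W) (hW'o : IsOpen W') (hsub : W' ⊆ W) : PLAlongOn n c c' h W' :=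
  hW.anti hW'o hsub IsPLOn.mono_holds

end Along

/-! ### PD maps from finite complexes with smooth models -/

section PDModels

variable {n : ℕ}

/-- **Smooth globalisation near a compact set.** A map `C^∞` on an open set `O ⊇ C`, `C` compact,
agrees near `C` with a globally `C^∞` map. [folklore] -/
theorem exists_contDiff_eventuallyEq_nhdsSet {Gm : 𝔼 n → 𝔼 n} {O C : Set (𝔼 n)} (hO : IsOpen O)
    (hGm : ContDiffOn ℝ ∞ Gm O) (hC : IsCompact C) (hCO : C ⊆ O) :
    ∃ g : 𝔼 n → 𝔼 n, ContDiff ℝ ∞ g ∧ ∀ᶠ z in 𝓝ˢ C, g z = Gm z := by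
  obtain ⟨r, hr, hrO⟩ := hC.exists_cthickening_subset_open hO hCO
  have hCt : C ⊆ interior (cthickening r C) :=
    (self_subset_thickening hr C).trans (interior_maximal (thickening_subset_cthickening r C) isOpen_thickening)
  obtain ⟨f, hf1, hf0, -⟩ := exists_contMDiffMap_one_nhds_of_subset_interior (𝓘(ℝ, 𝔼 n)) (n := ⊤)
    hC.isClosed hCt
  have hfs : ContDiff ℝ ∞ (f : 𝔼 n → ℝ) := contMDiff_iff_contDiff.1 f.contMDiff
  refine ⟨fun z => f z • Gm z, ?_, ?_⟩
  · rw [contDiff_iff_contDiffAt]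
    intro z
    by_cases hz : z ∈ O
    · exact hfs.contDiffAt.smul (hGm.contDiffAt (hO.mem_nhds hz))
    · have hzt : z ∉ cthickening r C := fun h => hz (hrO h)
      have hev : (fun y => f y • Gm y) =ᶠ[𝓝 z] fun _ => 0 := by
        filter_upwards [isClosed_cthickening.isOpen_compl.mem_nhds hzt] with y hy
        simp [hf0 y hy]
      exact contDiffAt_const.congr_of_eventuallyEq hev
  · filter_upwards [hf1] with z hz
    simp [hz]

/-- **Affine maps agreeing on a set have linear parts agreeing on its direction space.**
[folklore] -/
theorem linear_eqOn_vectorSpan {V W : Type*} [NormedAddCommGroup V] [NormedSpace ℝ V]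
    [NormedAddCommGroup W] [NormedSpace ℝ W] {A B : V →ᵃ[ℝ] W} {S : Set V}
    (h : EqOn A B S) : EqOn A.linear B.linear (vectorSpan ℝ S) := by
  rcases S.eq_empty_or_nonempty with rfl | ⟨p₀, hp₀⟩
  · intro v hv
    simp only [vectorSpan_empty, Submodule.bot_coe, mem_singleton_iff] at hv
    rw [hv, map_zero, map_zero]
  · rw [vectorSpan_eq_span_vsub_set_right ℝ hp₀]
    refine LinearMap.eqOn_span' ?_
    rintro _ ⟨p, hp, rfl⟩
    show A.linear (p -ᵥ p₀) = B.linear (p -ᵥ p₀)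
    rw [A.linearMap_vsub, B.linearMap_vsub, h hp, h hp₀]

/-- **PD from smooth models on the top simplices of a finite pure complex.** Let `Q` be a finite
complex in `ℝⁿ`, pure of dimension `n`, and let `β` have on every top simplex a `C^∞` model on an
open set containing the closed simplex, with derivative injective on the direction space.  Then `β`
is PD on the interior of `Q.space` (shrink the complex around the point, globalise the models).
[cite: Munkres1966, 8.3] -/
theorem isPDOn_of_top_models {Q : Geometry.SimplicialComplex ℝ (𝔼 n)} (hfin : Q.faces.Finite)
    (hpure : ∀ σ ∈ Q.faces, ∃ τ ∈ Q.faces, σ ⊆ τ ∧ τ.card = n + 1) {β : 𝔼 n → 𝔼 n}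
    (hmodel : ∀ τ ∈ Q.faces, τ.card = n + 1 → ∃ O : Set (𝔼 n), ∃ Gm : 𝔼 n → 𝔼 n, IsOpen O ∧
      convexHull ℝ (τ : Set (𝔼 n)) ⊆ O ∧ ContDiffOn ℝ ∞ Gm O ∧ EqOn β Gm (convexHull ℝ (τ : Set (𝔼 n))) ∧
      ∀ z ∈ convexHull ℝ (τ : Set (𝔼 n)), ∀ w ∈ vectorSpan ℝ (τ : Set (𝔼 n)),
        fderiv ℝ Gm z w = 0 → w = 0) :
    IsPDOn n β (interior Q.space) := by
  classical
  intro a ha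
  obtain ⟨Q', hQ'fin, hQ'a, hQ'sub, hQ'⟩ := exists_simplicialComplex_faces_subset_of_mem_nhds hfin
    (mem_interior_iff_mem_nhds.1 ha) (interior_mem_nhds.2 (mem_interior_iff_mem_nhds.1 ha))
  refine ⟨Q', hQ'fin, hQ'a, hQ'sub, fun σ' hσ' => ?_⟩
  obtain ⟨σ, hσ, hσ'σ⟩ := hQ' σ' hσ'
  obtain ⟨τ, hτ, hστ, hcard⟩ := hpure σ hσ
  have hσ'τ : convexHull ℝ (σ' : Set (𝔼 n)) ⊆ convexHull ℝ (τ : Set (𝔼 n)) :=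
    hσ'σ.trans (convexHull_mono (by exact_mod_cast hστ))
  obtain ⟨O, Gm, hO, hτO, hGm, hβ, hinj⟩ := hmodel τ hτ hcard
  obtain ⟨g, hg, hgGm⟩ := exists_contDiff_eventuallyEq_nhdsSet hO hGm
    (τ.finite_toSet.isCompact_convexHull (𝕜 := ℝ)) hτO
  -- the direction space of a top simplex is everything
  have htop : vectorSpan ℝ (τ : Set (𝔼 n)) = ⊤ := by
    have hind := Q.indep hτ
    have h1 : Fintype.card ↥τ = Module.finrank ℝ (𝔼 n) + 1 := by
      rw [Fintype.card_coe, finrank_euclideanSpace_fin, hcard]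
    have h2 := hind.vectorSpan_eq_top_of_card_eq_finrank_add_one h1
    rwa [Subtype.range_coe] at h2
  refine ⟨g, hg, fun z hz => ?_, fun z hz => ?_⟩
  · rw [hβ (hσ'τ hz)]
    exact ((hgGm.self_of_nhdsSet z (hσ'τ hz))).symm
  · have hz' : z ∈ convexHull ℝ (τ : Set (𝔼 n)) := hσ'τ hz
    have hev : g =ᶠ[𝓝 z] Gm := by
      have := hgGm
      rw [eventually_nhdsSet_iff_forall] at this
      exact this z hz'
    rw [hev.fderiv_eq]
    intro w₁ w₂ hw
    have h0 : fderiv ℝ Gm z (w₁ - w₂) = 0 := by rw [map_sub, hw, sub_self]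
    have := hinj z hz' (w₁ - w₂) (by rw [htop]; exact Submodule.mem_top) h0
    exact sub_eq_zero.1 this

end PDModels

/-! ### The comparison map of a bending step as a homeomorphism of `M` -/

section Homeo

variable {n N : ℕ} {M : Type*} [TopologicalSpace M] [T2Space M] {I : BendInput n N M}
  (S : I.BendSetup)

/-- **The comparison map `Ψ` is a homeomorphism of `M`** as soon as the bending region `Mq` and
its image lie in `V` and `Mq` is protected: `Ψ` is the identity off `Mq`, a homeomorphism of `V`
onto the open set `Ψ '' V`, injective across, and onto (protected points are covered,
`exists_open_subset_image`). [cite: Munkres1966, 10.2] -/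
theorem BendInput.BendSetup.exists_homeomorph_eq_Ψ (hMqV : I.Mq ⊆ S.V) (hΨMq : S.Ψ '' I.Mq ⊆ S.V)
    (hMqP : I.Mq ⊆ I.Prot) : ∃ Φ : M ≃ₜ M, (Φ : M → M) = S.Ψ := by
  classical
  -- injectivity
  have hinj : Injective S.Ψ := by
    intro p q h
    by_cases hp : p ∈ S.V <;> by_cases hq : q ∈ S.V
    · exact S.injOn_Ψ hp hq h
    · have hqM : q ∉ I.Mq := fun hqM => hq (hMqV hqM)
      rw [S.Ψ_eq_self hqM] at h
      by_cases hpM : p ∈ I.Mq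
      · exact (hq (h ▸ hΨMq ⟨p, hpM, rfl⟩)).elim
      · rwa [S.Ψ_eq_self hpM] at h
    · have hpM : p ∉ I.Mq := fun hpM => hp (hMqV hpM)
      rw [S.Ψ_eq_self hpM] at h
      by_cases hqM : q ∈ I.Mq
      · exact (hp (h.symm ▸ hΨMq ⟨q, hqM, rfl⟩)).elim
      · rwa [S.Ψ_eq_self hqM] at h
    · have hpM : p ∉ I.Mq := fun hpM => hp (hMqV hpM)
      have hqM : q ∉ I.Mq := fun hqM => hq (hMqV hqM)
      rwa [S.Ψ_eq_self hpM, S.Ψ_eq_self hqM] at h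
  -- surjectivity
  have hsurj : Surjective S.Ψ := by
    intro q
    by_cases hqM : q ∈ I.Mq
    · obtain ⟨U, -, hqU, hU⟩ := S.exists_open_subset_image (hMqP hqM)
      obtain ⟨x, hx, hxq⟩ := hU hqU
      exact ⟨I.f x, by rw [S.Ψ_f (S.Kb_space_subset hx), hxq]⟩
    · exact ⟨q, S.Ψ_eq_self hqM⟩
  -- continuity
  have hcont : Continuous S.Ψ := by
    rw [continuous_iff_continuousAt]
    intro p
    by_cases hp : p ∈ S.V
    · exact S.continuousOn_Ψ.continuousAt (S.isOpen_V.mem_nhds hp)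
    · have hpM : p ∉ I.Mq := fun hpM => hp (hMqV hpM)
      have hev : S.Ψ =ᶠ[𝓝 p] id := by
        filter_upwards [I.isCompact_Mq.isClosed.isOpen_compl.mem_nhds hpM] with q hq
        exact S.Ψ_eq_self hq
      exact (continuousAt_id.congr hev.symm)
  -- openness
  have hopen : IsOpenMap S.Ψ := by
    intro O hO
    have h1 : S.Ψ '' O = S.Ψ '' (O ∩ S.V) ∪ (O \ I.Mq) := by
      refine Subset.antisymm ?_ (union_subset (image_mono inter_subset_left) fun q hq => ?_)
      · rintro _ ⟨p, hp, rfl⟩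
        by_cases hpV : p ∈ S.V
        · exact Or.inl ⟨p, ⟨hp, hpV⟩, rfl⟩
        · have hpM : p ∉ I.Mq := fun hpM => hpV (hMqV hpM)
          exact Or.inr ⟨by rw [S.Ψ_eq_self hpM]; exact hp, by rw [S.Ψ_eq_self hpM]; exact hpM⟩
      · exact ⟨q, hq.1, S.Ψ_eq_self hq.2⟩
    have h2 : IsOpen (S.Ψ '' (O ∩ S.V)) := by
      have h3 : S.Ψ '' (O ∩ S.V) = S.Ψ '' S.V ∩ S.Ψinv ⁻¹' (O ∩ S.V) := by
        refine Subset.antisymm ?_ ?_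
        · rintro _ ⟨p, ⟨hpO, hpV⟩, rfl⟩
          exact ⟨⟨p, hpV, rfl⟩, by rw [mem_preimage, S.Ψinv_Ψ hpV]; exact ⟨hpO, hpV⟩⟩
        · rintro q ⟨hq, hqO⟩
          exact ⟨S.Ψinv q, hqO, (S.Ψ_Ψinv hq).1⟩
      rw [h3]
      exact S.continuousOn_Ψinv.isOpen_inter_preimage S.isOpen_image_V (hO.inter S.isOpen_V)
    rw [h1]
    exact h2.union (hO.sdiff I.isCompact_Mq.isClosed)
  exact ⟨(Equiv.ofBijective S.Ψ ⟨hinj, hsurj⟩).toHomeomorphOfContinuousOpen hcont hopen, rfl⟩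

end Homeo

/-! ### Smooth chart models of the bent map, and PD-ness in sheet coordinates -/

section BentModels

variable {n N : ℕ} {M : Type*} [TopologicalSpace M] [T2Space M] {I : BendInput n N M}
  (S : I.BendSetup)

/-- **Smooth chart models of the bent map on every top simplex of the refinement** (active
simplices: the explicit bent model `Bt`, `model_active`; unbent simplices: the model of `e ∘ f`),
when the whole underlying space is mapped into the chart source. [cite: Munkres1966, 10.2] -/
theorem BendInput.BendSetup.model_fbend_top (hsrc : ∀ x ∈ I.K.space, I.f x ∈ I.e.source)
    {t : Finset (Fin N → ℝ)} (ht : t ∈ S.PTop) :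
    ∃ O : Set (Fin N → ℝ), ∃ Gm : (Fin N → ℝ) → 𝔼 n, IsOpen O ∧
      convexHull ℝ (t : Set (Fin N → ℝ)) ⊆ O ∧ ContDiffOn ℝ ∞ Gm O ∧
      (∀ x ∈ convexHull ℝ (t : Set (Fin N → ℝ)), S.fbend x ∈ I.e.source ∧ I.e (S.fbend x) = Gm x) ∧
      ∀ x ∈ convexHull ℝ (t : Set (Fin N → ℝ)), ∀ u ∈ vectorSpan ℝ (t : Set (Fin N → ℝ)),
        fderiv ℝ Gm x u = 0 → u = 0 := by
  rcases S.active_or_unbent ht.1 with ⟨s, hs, hts, htZ⟩ | hunbent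
  · obtain ⟨hO, htO, hGm, hval, hinj⟩ := S.model_active hs ht hts htZ
    exact ⟨S.O s, S.Bt s t ht.1, hO, htO, hGm, hval, hinj⟩
  · obtain ⟨s, hs, hts⟩ := S.exists_top_of_mem_P ht.1
    obtain ⟨hO, hsub, hGm, hEq, hinj, -⟩ := S.hmodel s hs
    have htsrc : ∀ x ∈ convexHull ℝ (t : Set (Fin N → ℝ)),
        x ∈ convexHull ℝ (s : Set (Fin N → ℝ)) ∩ I.f ⁻¹' I.e.source := fun x hx =>
      ⟨hts hx, hsrc x (I.K.convexHull_subset_space hs.1 (hts hx))⟩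
    refine ⟨S.O s, S.G s, hO, fun x hx => hsub (htsrc x hx), hGm, fun x hx => ?_, fun x hx u hu h0 => ?_⟩
    · rw [hunbent hx]
      exact ⟨(htsrc x hx).2, hEq (htsrc x hx)⟩
    · exact hinj x (htsrc x hx) u (BendInput.BendSetup.vectorSpan_le_of_subset hts hu) h0

/-- **PD-ness of the bent map in sheet coordinates.** If `π : ℝᴺ → ℝⁿ` is linear and injective on
`K.space` and `β (π x) = e (f' x)` on `K.space`, then `β` is PD on the interior of `π '' K.space`
(transport the refinement along `π`, compose the models with affine left inverses).
[cite: Munkres1966, 8.3 and 10.2] -/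
theorem BendInput.BendSetup.isPDOn_transport (hsrc : ∀ x ∈ I.K.space, I.f x ∈ I.e.source)
    (π : (Fin N → ℝ) →ₗ[ℝ] 𝔼 n) (hπ : InjOn π I.K.space) {β : 𝔼 n → 𝔼 n}
    (hβ : ∀ x ∈ I.K.space, β (π x) = I.e (S.fbend x)) : IsPDOn n β (interior (π '' I.K.space)) := by
  classical
  have hPsp : S.P.space = I.K.space := S.P_space
  obtain ⟨Q, hQfaces, hQhull⟩ := exists_simplicialComplex_image S.P π
    (fun t _ => ⟨π.toAffineMap, fun _ _ => rfl⟩) (by rw [hPsp]; exact hπ)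
  have hQfin : Q.faces.Finite := by
    have : Q.faces = (fun t => t.image π) '' S.P.faces := by
      ext t; rw [hQfaces t, Set.mem_image]
    rw [this]; exact S.P_finite.image _
  have hcard : ∀ t ∈ S.P.faces, (t.image π).card = t.card := fun t ht =>
    Finset.card_image_of_injOn (hπ.mono (by
      rw [← hPsp]; exact (subset_convexHull ℝ _).trans (S.P.convexHull_subset_space ht)))
  have hQspace : Q.space = π '' I.K.space := by
    rw [← hPsp]
    refine Subset.antisymm (fun z hz => ?_) ?_
    · obtain ⟨τ, hτ, hzτ⟩ := Geometry.SimplicialComplex.mem_space_iff.1 hz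
      obtain ⟨t, ht, rfl⟩ := (hQfaces τ).1 hτ
      rw [hQhull t ht] at hzτ
      exact image_mono (S.P.convexHull_subset_space ht) hzτ
    · rintro _ ⟨x, hx, rfl⟩
      obtain ⟨t, ht, hxt⟩ := Geometry.SimplicialComplex.mem_space_iff.1 hx
      refine Geometry.SimplicialComplex.mem_space_iff.2 ⟨t.image π, (hQfaces _).2 ⟨t, ht, rfl⟩, ?_⟩
      rw [hQhull t ht]; exact ⟨x, hxt, rfl⟩
  rw [← hQspace]
  refine isPDOn_of_top_models hQfin (fun σ hσ => ?_) fun τ hτ hτcard => ?_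
  · obtain ⟨t, ht, rfl⟩ := (hQfaces σ).1 hσ
    obtain ⟨t', ht', htt', hc'⟩ := S.exists_subset_card_of_mem_P ht
    exact ⟨t'.image π, (hQfaces _).2 ⟨t', ht', rfl⟩, Finset.image_subset_image htt',
      by rw [hcard t' ht', hc']⟩
  · obtain ⟨t, ht, rfl⟩ := (hQfaces τ).1 hτ
    have htcard : t.card = n + 1 := by rw [← hcard t ht, hτcard]
    obtain ⟨O, Gm, hO, htO, hGm, hval, hinj⟩ := S.model_fbend_top hsrc ⟨ht, htcard⟩
    -- affine left inverse of `π` on the closed simplex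
    have hπt : InjOn π.toAffineMap (convexHull ℝ (t : Set (Fin N → ℝ))) :=
      hπ.mono (by rw [← hPsp]; exact S.P.convexHull_subset_space ht)
    obtain ⟨B, hB⟩ := exists_affine_leftInv π.toAffineMap hπt
    have hBc : Continuous B := B.continuous_of_finiteDimensional
    refine ⟨B ⁻¹' O, Gm ∘ B, hO.preimage hBc, ?_, ?_, ?_, ?_⟩
    · rw [hQhull t ht]
      rintro _ ⟨x, hx, rfl⟩
      show B (π.toAffineMap x) ∈ O
      rw [hB x hx]; exact htO hx
    · exact hGm.comp (contDiff_affineMap B).contDiffOn fun z hz => hz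
    · rw [hQhull t ht]
      rintro _ ⟨x, hx, rfl⟩
      show β (π x) = Gm (B (π.toAffineMap x))
      rw [hB x hx, hβ x (by rw [← hPsp]; exact S.P.convexHull_subset_space ht hx), (hval x hx).2]
    · rw [hQhull t ht]
      rintro _ ⟨x, hx, rfl⟩ w hw h0
      have hBπ : B (π x) = x := hB x hx
      -- chain rule
      have hdB : HasFDerivAt B (LinearMap.toContinuousLinearMap B.linear) (π x) := hasFDerivAt_affineMap B _
      have hdG : HasFDerivAt Gm (fderiv ℝ Gm x) (B (π x)) := by
        rw [hBπ]
        exact ((hGm.contDiffAt (hO.mem_nhds (htO hx))).differentiableAt (by simp)).hasFDerivAt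
      have hcomp : HasFDerivAt (Gm ∘ B) ((fderiv ℝ Gm x).comp (LinearMap.toContinuousLinearMap B.linear)) (π x) :=
        hdG.comp (π x) hdB
      rw [hcomp.fderiv] at h0
      simp only [ContinuousLinearMap.coe_comp, Function.comp_apply, LinearMap.coe_toContinuousLinearMap'] at h0
      -- `B.linear w` is a direction of `t`
      have himg : B '' convexHull ℝ ((t.image π : Finset (𝔼 n)) : Set (𝔼 n)) ⊆ convexHull ℝ (t : Set (Fin N → ℝ)) := by
        rw [hQhull t ht]
        rintro _ ⟨_, ⟨y, hy, rfl⟩, rfl⟩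
        show B (π.toAffineMap y) ∈ _
        rw [hB y hy]; exact hy
      have hBw : B.linear w ∈ vectorSpan ℝ (t : Set (Fin N → ℝ)) := linear_mem_vectorSpan B himg hw
      have hBw0 : B.linear w = 0 := hinj x hx _ hBw h0
      -- and `π (B.linear w) = w`
      have hid : EqOn (π.toAffineMap.comp B) (AffineMap.id ℝ (𝔼 n))
          (convexHull ℝ ((t.image π : Finset (𝔼 n)) : Set (𝔼 n))) := by
        rw [hQhull t ht]
        rintro _ ⟨y, hy, rfl⟩
        show π (B (π.toAffineMap y)) = π y
        rw [hB y hy]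
      have hlin := linear_eqOn_vectorSpan hid
      have hw' : w ∈ vectorSpan ℝ (convexHull ℝ ((t.image π : Finset (𝔼 n)) : Set (𝔼 n))) := by
        rw [← direction_affineSpan, affineSpan_convexHull, direction_affineSpan]; exact hw
      have h1 := hlin hw'
      simp only [AffineMap.comp_linear, LinearMap.toAffineMap_linear, AffineMap.id_linear,
        LinearMap.comp_apply, LinearMap.id_apply] at h1
      rw [← h1, hBw0, map_zero]

end BentModels

/-! ### Pieces and stage inputs -/

section Stage

variable (n : ℕ) (M : Type*) [TopologicalSpace M]

/-- **A cover piece of the uniqueness induction**: a chart `ψ` of the smooth atlas, charts `e₁`,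
`e₂` of the two PL atlases, and ten concentric closed balls `B 0 ⋐ B 1 ⋐ ⋯ ⋐ B 9` in `ψ.target`
with a common margin `η` (`B 0` is the new core, `B 1` the region gained, `B 2,…,B 5` the
levels `R₁,…,R₄` of the bending step, `B 6` the protected set, `B 8` the sheet region).
(Bookkeeping structure, not a named fact.) [cite: Munkres1966, 10.5–10.6] -/
structure UPiece (cD c₁ c₂ : ChartedSpace (𝔼 n) M) where
  /-- the smooth chart -/
  ψ : OpenPartialHomeomorph M (𝔼 n)
  hψ : ψ ∈ @atlas (𝔼 n) _ M _ cD
  /-- the chart of the first PL structure -/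
  e₁ : OpenPartialHomeomorph M (𝔼 n)
  he₁ : e₁ ∈ @atlas (𝔼 n) _ M _ c₁
  /-- the chart of the second PL structure -/
  e₂ : OpenPartialHomeomorph M (𝔼 n)
  he₂ : e₂ ∈ @atlas (𝔼 n) _ M _ c₂
  /-- centre and radii of the balls -/
  z : 𝔼 n
  ρ : Fin 10 → ℝ
  /-- the margin -/
  η : ℝ
  hη : 0 < η
  hρ0 : 0 < ρ 0
  hρ : ∀ ℓ : Fin 9, ρ ℓ.castSucc + η ≤ ρ ℓ.succ
  htarget : closedBall z (ρ 9) ⊆ ψ.target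

variable {n M} {cD c₁ c₂ : ChartedSpace (𝔼 n) M} (P : UPiece n M cD c₁ c₂)

namespace UPiece

/-- The `ℓ`-th ball of the piece. [folklore] -/
def B (ℓ : Fin 10) : Set (𝔼 n) := closedBall P.z (P.ρ ℓ)

/-- Auxiliary (`B_def`). [folklore] -/
theorem B_def (ℓ : Fin 10) : P.B ℓ = closedBall P.z (P.ρ ℓ) := rfl

/-- The balls are compact. [folklore] -/
theorem isCompact_B (ℓ : Fin 10) : IsCompact (P.B ℓ) := isCompact_closedBall _ _

/-- The radii increase by at least `η`. [folklore] -/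
theorem ρ_mono {ℓ ℓ' : Fin 10} (h : ℓ ≤ ℓ') : P.ρ ℓ + (ℓ' - ℓ : ℕ) * P.η ≤ P.ρ ℓ' := by
  obtain ⟨ℓ, hℓ⟩ := ℓ
  obtain ⟨ℓ', hℓ'⟩ := ℓ'
  simp only [Fin.le_def] at h
  simp only
  induction ℓ' with
  | zero =>
    have : ℓ = 0 := Nat.le_zero.1 h
    subst this; simp
  | succ k ih =>
    rcases Nat.lt_or_ge ℓ (k + 1) with hlt | hge
    · have hk : ℓ ≤ k := Nat.lt_succ_iff.1 hlt
      have h1 := ih (by omega) hk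
      have h2 := P.hρ ⟨k, by omega⟩
      simp only [Fin.castSucc_mk, Fin.succ_mk] at h2
      have h3 : ((k + 1 - ℓ : ℕ) : ℝ) = (k - ℓ : ℕ) + 1 := by
        rw [Nat.succ_sub hk]; push_cast; ring
      rw [h3]
      linarith
    · have : ℓ = k + 1 := le_antisymm h hge
      subst this; simp

/-- The radii are positive and the balls are nested with margin `η`. [folklore] -/
theorem ρ_pos (ℓ : Fin 10) : 0 < P.ρ ℓ := by
  have h := P.ρ_mono (Fin.zero_le ℓ)
  have : (0 : ℝ) ≤ (((ℓ : ℕ) - ((0 : Fin 10) : ℕ) : ℕ) : ℝ) * P.η := by have := P.hη; positivity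
  linarith [P.hρ0]

/-- Auxiliary (`cthickening_B_subset`). [folklore] -/
theorem cthickening_B_subset {ℓ ℓ' : Fin 10} (h : ℓ < ℓ') : cthickening P.η (P.B ℓ) ⊆ P.B ℓ' := by
  rw [B_def, B_def, cthickening_closedBall P.hη.le (P.ρ_pos ℓ).le]
  refine closedBall_subset_closedBall ?_
  have h1 := P.ρ_mono h.le
  have h2 : (1 : ℝ) ≤ (ℓ' - ℓ : ℕ) := by
    have : 1 ≤ (ℓ' - ℓ : ℕ) := by
      have := Fin.lt_def.1 h; omega
    exact_mod_cast this
  nlinarith [P.hη]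

/-- Auxiliary (`B_mono`). [folklore] -/
theorem B_mono {ℓ ℓ' : Fin 10} (h : ℓ ≤ ℓ') : P.B ℓ ⊆ P.B ℓ' := by
  rcases h.lt_or_eq with h | h
  · exact (self_subset_cthickening _).trans (P.cthickening_B_subset h)
  · rw [h]

/-- Auxiliary (`B_subset_target`). [folklore] -/
theorem B_subset_target (ℓ : Fin 10) : P.B ℓ ⊆ P.ψ.target :=
  (P.B_mono (Fin.le_last ℓ) : P.B ℓ ⊆ P.B 9).trans P.htarget

/-- Auxiliary (`B_subset_interior`). [folklore] -/
theorem B_subset_interior {ℓ ℓ' : Fin 10} (h : ℓ < ℓ') : P.B ℓ ⊆ interior (P.B ℓ') := by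
  rw [B_def, B_def]
  have h1 := P.ρ_mono h.le
  have h2 : (1 : ℝ) ≤ (ℓ' - ℓ : ℕ) := by
    have : 1 ≤ (ℓ' - ℓ : ℕ) := by
      have := Fin.lt_def.1 h; omega
    exact_mod_cast this
  refine (closedBall_subset_ball (by nlinarith [P.hη])).trans ?_
  exact interior_maximal ball_subset_closedBall isOpen_ball

/-- The image of a ball in `M`. [folklore] -/
def MB (ℓ : Fin 10) : Set M := P.ψ.symm '' P.B ℓ

/-- Auxiliary (`isCompact_MB`). [folklore] -/
theorem isCompact_MB (ℓ : Fin 10) : IsCompact (P.MB ℓ) :=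
  (P.isCompact_B ℓ).image_of_continuousOn (P.ψ.continuousOn_symm.mono (P.B_subset_target ℓ))

/-- Auxiliary (`MB_subset_source`). [folklore] -/
theorem MB_subset_source (ℓ : Fin 10) : P.MB ℓ ⊆ P.ψ.source := by
  rintro _ ⟨y, hy, rfl⟩; exact P.ψ.map_target (P.B_subset_target ℓ hy)

/-- Auxiliary (`MB_mono`). [folklore] -/
theorem MB_mono {ℓ ℓ' : Fin 10} (h : ℓ ≤ ℓ') : P.MB ℓ ⊆ P.MB ℓ' := image_mono (P.B_mono h)

/-- Membership in `MB ℓ` via the chart. [folklore] -/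
theorem mem_MB_iff {ℓ : Fin 10} {q : M} : q ∈ P.MB ℓ ↔ q ∈ P.ψ.source ∧ P.ψ q ∈ P.B ℓ := by
  constructor
  · rintro ⟨y, hy, rfl⟩
    exact ⟨P.ψ.map_target (P.B_subset_target ℓ hy), by rw [P.ψ.right_inv (P.B_subset_target ℓ hy)]; exact hy⟩
  · rintro ⟨hq, hqB⟩
    exact ⟨P.ψ q, hqB, P.ψ.left_inv hq⟩

/-- **The smooth cut-off of the piece**: `C^∞`, valued in `[0,1]`, `= 1` on `B 3`, `= 0` off
`B 4`. [folklore] -/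
theorem exists_theta : ∃ θ : (𝔼 n) → ℝ, ContDiff ℝ ∞ θ ∧ (∀ y, θ y ∈ Icc (0 : ℝ) 1) ∧
    (∀ y ∈ P.B 3, θ y = 1) ∧ ∀ y ∉ P.B 4, θ y = 0 := by
  have h34 : P.B 3 ⊆ interior (P.B 4) := P.B_subset_interior (by decide)
  obtain ⟨f, h1, h0, h01⟩ := exists_contMDiffMap_one_nhds_of_subset_interior (𝓘(ℝ, 𝔼 n)) (n := ⊤)
    (P.isCompact_B 3).isClosed h34
  refine ⟨f, ?_, h01, fun y hy => ?_, h0⟩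
  · exact contMDiff_iff_contDiff.1 f.contMDiff
  · exact h1.self_of_nhdsSet y hy

/-- The cut-off. [folklore] -/
def theta : (𝔼 n) → ℝ := P.exists_theta.choose

/-- Auxiliary (`theta_spec`). [folklore] -/
theorem theta_spec : ContDiff ℝ ∞ P.theta ∧ (∀ y, P.theta y ∈ Icc (0 : ℝ) 1) ∧
    (∀ y ∈ P.B 3, P.theta y = 1) ∧ ∀ y ∉ P.B 4, P.theta y = 0 := P.exists_theta.choose_spec

end UPiece

/-! ### Enlarging the fineness of a set-up -/

/-- Elementary: `X / m' ≤ X / m` for `0 ≤ X` and `0 < m ≤ m'`. [folklore] -/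
theorem div_nat_mono {X : ℝ} (hX : 0 ≤ X) {m m' : ℕ} (hm : 0 < m) (hle : m ≤ m') :
    X / (m' : ℝ) ≤ X / (m : ℝ) :=
  div_le_div_of_nonneg_left hX (by exact_mod_cast hm) (by exact_mod_cast hle)

/-- **A set-up stays a set-up under enlarging the fineness** (all its requirements on `m` are
lower bounds). [folklore] -/
def _root_.Literature.Topology.FourManifolds.BendInput.BendSetup.enlarge {N : ℕ} [T2Space M]
    {I : BendInput n N M} (S : I.BendSetup) (m' : ℕ) (hle : S.m ≤ m') : I.BendSetup :=
  { S with
    m := m'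
    hm := lt_of_lt_of_le S.hm hle
    hm_τ := (div_nat_mono zero_le_one S.hm hle).trans S.hm_τ
    hm_δ := (div_nat_mono (NNReal.coe_nonneg _) S.hm hle).trans S.hm_δ
    hm_A := by
      have hX : 0 ≤ (((n : ℝ) + 1) * (S.B₂ : ℝ) / S.c + (S.B₂ : ℝ)) / S.μ' + S.Θ * (S.B₁ : ℝ) := by
        have := S.hc; have := S.hμ'; have := S.hΘ; positivity
      exact (div_nat_mono hX S.hm hle).trans S.hm_A
    hm_K := by
      have hX : 0 ≤ S.Θ * (S.B₁ : ℝ) * (S.B₁ : ℝ) +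
          ((n : ℝ) + 1) * ((n : ℝ) + 1) * (S.B₂ : ℝ) / S.c / S.c := by
        have := S.hc; have := S.hΘ; positivity
      exact (div_nat_mono hX S.hm hle).trans S.hm_K }

/-- Auxiliary (`enlarge_m`). [folklore] -/
@[simp] theorem _root_.Literature.Topology.FourManifolds.BendInput.BendSetup.enlarge_m {N : ℕ}
    [T2Space M] {I : BendInput n N M} (S : I.BendSetup) (m' : ℕ) (hle : S.m ≤ m') :
    (S.enlarge m' hle).m = m' := rfl

/-! ### Stage inputs -/

variable (n M)

/-- **The input of a stage of the uniqueness induction**: a piece, the two current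
homeomorphisms `F, G` (PD along the two PL structures), the open set `A` over which `F⁻¹ ∘ G` is
known to be PL (in both directions), a closed `Acl ⊆ A` and an open `Am ⊆ Acl` with a chart
margin `γ` (points of the piece within chart distance `γ` of `Am` lie in `Acl`), the drift
hypotheses (the top ball lies in the images of the PL chart sources) and a requested tolerance
`ε`. (Bookkeeping structure, not a named fact.) [cite: Munkres1966, Thm 10.5] -/
structure UStageIn (cD c₁ c₂ : ChartedSpace (𝔼 n) M) where
  /-- positive dimension -/
  hn : 0 < n
  /-- the piece -/
  P : UPiece n M cD c₁ c₂
  /-- the maps -/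
  F : M ≃ₜ M
  G : M ≃ₜ M
  hF : PDAlong n c₁ cD F
  hG : PDAlong n c₂ cD G
  /-- the PL region -/
  A : Set M
  hA : IsOpen A
  hPL : PLAlongOn n c₂ c₁ (G.trans F.symm) (G ⁻¹' A)
  hPL' : PLAlongOn n c₁ c₂ (F.trans G.symm) (F ⁻¹' A)
  Acl : Set M
  hAcl : IsClosed Acl
  hAclA : Acl ⊆ A
  Am : Set M
  hAm : IsOpen Am
  hAmAcl : Am ⊆ Acl
  /-- the chart margin -/
  γ : ℝ
  hγ : 0 < γ
  hmargin : ∀ q ∈ P.ψ.source, ∀ q' ∈ P.ψ.source, P.ψ q ∈ P.B 9 → ‖P.ψ q' - P.ψ q‖ ≤ γ →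
    q' ∈ Am → q ∈ Acl
  /-- drift hypotheses -/
  hdriftF : P.ψ.symm '' P.B 9 ⊆ F '' P.e₁.source
  hdriftG : P.ψ.symm '' P.B 9 ⊆ G '' P.e₂.source
  /-- the requested tolerance -/
  ε : ℝ
  hε : 0 < ε

variable {n M} [T2Space M] (I : UStageIn n M cD c₁ c₂)

-- `[T2Space M]` is a section variable used by most lemmas below; per-lemma `omit` would be noise.
set_option linter.unusedSectionVars false

namespace UStageIn

/-- The compact set near which the two bends must agree: `MB 5 ∩ Acl`. [folklore] -/
def Zc : Set M := I.P.MB 5 ∩ I.Acl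

/-- Auxiliary (`isCompact_Zc`). [folklore] -/
theorem isCompact_Zc : IsCompact I.Zc := (I.P.isCompact_MB 5).inter_right I.hAcl

/-- The chart-level PD hypothesis for `F`. [folklore] -/
theorem isPDOn_F : IsPDOn n (I.P.ψ ∘ I.F ∘ I.P.e₁.symm)
    (I.P.e₁.target ∩ I.P.e₁.symm ⁻¹' (I.F ⁻¹' I.P.ψ.source)) :=
  I.hF.isPDOn I.P.e₁ I.P.he₁ I.P.ψ I.P.hψ

/-- The chart-level PD hypothesis for `G`. [folklore] -/
theorem isPDOn_G : IsPDOn n (I.P.ψ ∘ I.G ∘ I.P.e₂.symm)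
    (I.P.e₂.target ∩ I.P.e₂.symm ⁻¹' (I.G ⁻¹' I.P.ψ.source)) :=
  I.hG.isPDOn I.P.e₂ I.P.he₂ I.P.ψ I.P.hψ

/-- The chart-level PL hypothesis for the comparison map. [folklore] -/
theorem isPLOn_lam : IsPLOn n n (I.P.e₁ ∘ I.F.symm ∘ I.G ∘ I.P.e₂.symm)
    (I.P.e₂.target ∩ I.P.e₂.symm ⁻¹' (I.G ⁻¹' I.A ∩ (I.F.symm ∘ I.G) ⁻¹' I.P.e₁.source)) :=
  I.hPL.isPLOn I.P.e₂ I.P.he₂ I.P.e₁ I.P.he₁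

/-- **The two sheets of the stage** (a choice). [folklore] -/
def T : TwoSheets I.P.ψ I.P.e₁ I.P.e₂ I.F I.G (I.G ⁻¹' I.A) (I.P.B 8) I.Zc :=
  (exists_twoSheets I.P.ψ I.P.e₁ I.P.e₂ I.F I.G I.isPDOn_F I.isPDOn_G
    (I.hA.preimage I.G.continuous) I.isPLOn_lam (I.P.isCompact_B 8) (I.P.B_subset_target 8)
    ((image_mono (I.P.B_mono (by decide))).trans I.hdriftF)
    ((image_mono (I.P.B_mono (by decide))).trans I.hdriftG) I.isCompact_Zc
    (inter_subset_left.trans (image_mono (by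
      rw [UPiece.B_def, UPiece.B_def, interior_closedBall _ (I.P.ρ_pos 8).ne']
      have h := I.P.ρ_mono (show (5 : Fin 10) ≤ 8 by decide)
      exact closedBall_subset_ball (by norm_num at h; linarith [I.P.hη]))))
    (fun p hp => I.hAclA hp.2)).some

/-- **The coordinates of the two sheets** (a choice). [folklore] -/
def C : SheetCoords I.T := (exists_sheetCoords I.hn I.T).some

/-- The image of the first coordinate sheet map. [folklore] -/
theorem fK_image : I.C.fK '' I.C.PK.space = I.F '' (I.P.e₁.symm '' I.T.K.space) := by
  rw [← I.C.realK_space, Set.image_image, Set.image_image]; rfl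

/-- The image of the second coordinate sheet map. [folklore] -/
theorem fL_image : I.C.fL '' I.C.PL.space = I.G '' (I.P.e₂.symm '' I.T.L.space) := by
  rw [← I.C.realL_space, Set.image_image, Set.image_image]; rfl

/-- The requested tolerance of the two bends: `min ε γ`. [folklore] -/
def εb : ℝ := min I.ε I.γ

/-- Auxiliary (`εb_pos`). [folklore] -/
theorem εb_pos : 0 < I.εb := lt_min I.hε I.hγ

/-- **The bending input of the first sheet.** [folklore] -/
def IK : BendInput n I.C.N M where
  K := I.C.PK
  hK := I.C.isCoordinate_PK
  pure := I.C.PK_pure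
  f := I.C.fK
  inj := I.C.injOn_fK
  cont := fun _ hs => I.C.continuousOn_fK hs
  e := I.P.ψ
  model := fun _ hs _ => I.C.model_fK hs
  R₁ := I.P.B 2
  R₂ := I.P.B 3
  R₃ := I.P.B 4
  R₄ := I.P.B 5
  hR₁ := I.P.isCompact_B 2
  hR₂ := I.P.isCompact_B 3
  hR₃ := I.P.isCompact_B 4
  hR₄ := I.P.isCompact_B 5
  η := I.P.η
  hη := I.P.hη
  h12 := I.P.cthickening_B_subset (by decide)
  h23 := I.P.B_mono (by decide)
  h34 := I.P.cthickening_B_subset (by decide)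
  hR₄t := I.P.B_subset_target 5
  θ := I.P.theta
  hθ := I.P.theta_spec.1
  hθ01 := I.P.theta_spec.2.1
  hθ1 := I.P.theta_spec.2.2.1
  hθ0 := I.P.theta_spec.2.2.2
  Prot := I.P.MB 6
  hProt := I.P.isCompact_MB 6
  hProtint := by
    rw [fK_image]
    exact (I.P.MB_mono (by decide)).trans I.T.hKcov
  εreq := I.εb
  hεreq := I.εb_pos

/-- **The bending input of the second sheet.** [folklore] -/
def IL : BendInput n I.C.N M where
  K := I.C.PL
  hK := I.C.isCoordinate_PL
  pure := I.C.PL_pure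
  f := I.C.fL
  inj := I.C.injOn_fL
  cont := fun _ hs => I.C.continuousOn_fL hs
  e := I.P.ψ
  model := fun _ hs _ => I.C.model_fL hs
  R₁ := I.P.B 2
  R₂ := I.P.B 3
  R₃ := I.P.B 4
  R₄ := I.P.B 5
  hR₁ := I.P.isCompact_B 2
  hR₂ := I.P.isCompact_B 3
  hR₃ := I.P.isCompact_B 4
  hR₄ := I.P.isCompact_B 5
  η := I.P.η
  hη := I.P.hη
  h12 := I.P.cthickening_B_subset (by decide)
  h23 := I.P.B_mono (by decide)
  h34 := I.P.cthickening_B_subset (by decide)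
  hR₄t := I.P.B_subset_target 5
  θ := I.P.theta
  hθ := I.P.theta_spec.1
  hθ01 := I.P.theta_spec.2.1
  hθ1 := I.P.theta_spec.2.2.1
  hθ0 := I.P.theta_spec.2.2.2
  Prot := I.P.MB 6
  hProt := I.P.isCompact_MB 6
  hProtint := by
    rw [fL_image]
    exact (I.P.MB_mono (by decide)).trans I.T.hLcov
  εreq := I.εb
  hεreq := I.εb_pos

/-- The common fineness. [folklore] -/
def m : ℕ := max I.IK.exists_setup.some.m I.IL.exists_setup.some.m

/-- **The set-up of the first bend**, at the common fineness. [folklore] -/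
def SK : I.IK.BendSetup := I.IK.exists_setup.some.enlarge I.m (le_max_left _ _)

/-- **The set-up of the second bend**, at the common fineness. [folklore] -/
def SL : I.IL.BendSetup := I.IL.exists_setup.some.enlarge I.m (le_max_right _ _)

/-- Auxiliary (`SK_m`). [folklore] -/
theorem SK_m : I.SK.m = I.m := rfl

/-- Auxiliary (`SL_m`). [folklore] -/
theorem SL_m : I.SL.m = I.m := rfl

/-! #### The two bends agree on the shared coordinate simplices -/

/-- The shared part of the coordinate space. [folklore] -/
def ShSp : Set (Fin I.C.N → ℝ) := ⋃ τ ∈ I.C.ShC, convexHull ℝ (τ : Set (Fin I.C.N → ℝ))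

/-- Auxiliary (`shSp_subset_PK`). [folklore] -/
theorem shSp_subset_PK : I.ShSp ⊆ I.C.PK.space := fun x hx => by
  obtain ⟨τ, hτ, hxτ⟩ := mem_iUnion₂.1 hx
  exact I.C.PK.convexHull_subset_space (I.C.mem_PK_of_shC hτ) hxτ

/-- Auxiliary (`shSp_subset_PL`). [folklore] -/
theorem shSp_subset_PL : I.ShSp ⊆ I.C.PL.space := fun x hx => by
  obtain ⟨τ, hτ, hxτ⟩ := mem_iUnion₂.1 hx
  exact I.C.PL.convexHull_subset_space (I.C.mem_PL_of_shC hτ) hxτ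

/-- The chart images of the two sheet maps agree on the shared part. [folklore] -/
theorem F_eq_F {x : Fin I.C.N → ℝ} (hx : x ∈ I.ShSp) : I.IK.F x = I.IL.F x := by
  obtain ⟨τ, hτ, hxτ⟩ := mem_iUnion₂.1 hx
  show I.P.ψ (I.C.fK x) = I.P.ψ (I.C.fL x)
  rw [I.C.fK_eq_fL hτ hxτ]

/-- **The two secant maps agree on the shared part.** [cite: Munkres1966, 10.2] -/
theorem Λ_eq_Λ {x : Fin I.C.N → ℝ} (hx : x ∈ I.ShSp) : I.SK.Λ x = I.SL.Λ x := by
  obtain ⟨τ, hτ, hxτ⟩ := mem_iUnion₂.1 hx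
  exact plMap_latticeRefinement_eqOn I.C.isCoordinate_PK I.C.isCoordinate_PL (I.C.mem_PK_of_shC hτ)
    (I.C.mem_PL_of_shC hτ) (fun y hy => by
      show I.P.ψ (I.C.fK y) = I.P.ψ (I.C.fL y)
      rw [I.C.fK_eq_fL hτ hy]) hxτ

/-- **The two bent maps agree on the shared part.** [cite: Munkres1966, 10.2] -/
theorem fbend_eq_fbend {x : Fin I.C.N → ℝ} (hx : x ∈ I.ShSp) : I.SK.fbend x = I.SL.fbend x := by
  obtain ⟨τ, hτ, hxτ⟩ := mem_iUnion₂.1 hx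
  have hxK : x ∈ I.IK.D := ⟨I.shSp_subset_PK hx, I.C.fK_mem_source (I.shSp_subset_PK hx)⟩
  have hxL : x ∈ I.IL.D := ⟨I.shSp_subset_PL hx, I.C.fL_mem_source (I.shSp_subset_PL hx)⟩
  rw [I.SK.fbend_of_mem hxK, I.SL.fbend_of_mem hxL]
  show I.P.ψ.symm (I.SK.Bmap x) = I.P.ψ.symm (I.SL.Bmap x)
  simp only [BendInput.BendSetup.Bmap, I.F_eq_F hx, I.Λ_eq_Λ hx]
  rfl

/-- **The two comparison maps agree on the image of the shared part.** [cite: Munkres1966, 10.2] -/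
theorem Ψ_eq_Ψ {q : M} (hq : q ∈ I.C.fK '' I.ShSp) : I.SK.Ψ q = I.SL.Ψ q := by
  obtain ⟨x, hx, rfl⟩ := hq
  obtain ⟨τ, hτ, hxτ⟩ := mem_iUnion₂.1 hx
  rw [show I.C.fK x = I.IK.f x from rfl, I.SK.Ψ_f (I.shSp_subset_PK hx), I.fbend_eq_fbend hx,
    show I.IK.f x = I.IL.f x from I.C.fK_eq_fL hτ hxτ, I.SL.Ψ_f (I.shSp_subset_PL hx)]

/-! #### The two comparison homeomorphisms -/

/-- The bending region of the first bend lies in `MB 5`. [folklore] -/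
theorem IK_Mq_subset : I.IK.Mq ⊆ I.P.MB 5 := by
  rintro _ ⟨x, hx, rfl⟩
  have h45 : cthickening (I.P.η / 4) (I.P.B 4) ⊆ I.P.B 5 :=
    (cthickening_mono (by linarith [I.P.hη]) _).trans (I.P.cthickening_B_subset (by decide))
  have hx' := (mem_zone_iff (K := I.C.PK) (f := I.C.fK) (e := I.P.ψ)
    (h45.trans (I.P.B_subset_target 5))).1 hx
  rw [I.P.mem_MB_iff]
  exact ⟨hx'.2.1, h45 hx'.2.2⟩

/-- The bending region of the second bend lies in `MB 5`. [folklore] -/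
theorem IL_Mq_subset : I.IL.Mq ⊆ I.P.MB 5 := by
  rintro _ ⟨x, hx, rfl⟩
  have h45 : cthickening (I.P.η / 4) (I.P.B 4) ⊆ I.P.B 5 :=
    (cthickening_mono (by linarith [I.P.hη]) _).trans (I.P.cthickening_B_subset (by decide))
  have hx' := (mem_zone_iff (K := I.C.PL) (f := I.C.fL) (e := I.P.ψ)
    (h45.trans (I.P.B_subset_target 5))).1 hx
  rw [I.P.mem_MB_iff]
  exact ⟨hx'.2.1, h45 hx'.2.2⟩

/-- Points of `V ∩ MB 5` are moved into `MB 6` by the first comparison map. [folklore] -/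
theorem SK_Ψ_mem {q : M} (hqV : q ∈ I.SK.V) (hq : q ∈ I.P.MB 5) : I.SK.Ψ q ∈ I.P.MB 6 := by
  rw [I.P.mem_MB_iff] at hq ⊢
  obtain ⟨hs, hle⟩ := I.SK.norm_e_Ψ_sub_le hqV hq.1
  refine ⟨hs, ?_⟩
  have hδ : I.SK.δ₀ ≤ I.P.η := by have := I.SK.δ₀_le_eta; show _ ≤ I.IK.η; linarith [I.IK.hη]
  have h56 : cthickening I.P.η (I.P.B 5) ⊆ I.P.B 6 := I.P.cthickening_B_subset (by decide)
  exact h56 (mem_cthickening_of_dist_le _ _ _ _ hq.2 (by rw [dist_eq_norm]; exact hle.trans hδ))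

/-- Points of `V ∩ MB 5` are moved into `MB 6` by the second comparison map. [folklore] -/
theorem SL_Ψ_mem {q : M} (hqV : q ∈ I.SL.V) (hq : q ∈ I.P.MB 5) : I.SL.Ψ q ∈ I.P.MB 6 := by
  rw [I.P.mem_MB_iff] at hq ⊢
  obtain ⟨hs, hle⟩ := I.SL.norm_e_Ψ_sub_le hqV hq.1
  refine ⟨hs, ?_⟩
  have hδ : I.SL.δ₀ ≤ I.P.η := by have := I.SL.δ₀_le_eta; show _ ≤ I.IL.η; linarith [I.IL.hη]
  have h56 : cthickening I.P.η (I.P.B 5) ⊆ I.P.B 6 := I.P.cthickening_B_subset (by decide)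
  exact h56 (mem_cthickening_of_dist_le _ _ _ _ hq.2 (by rw [dist_eq_norm]; exact hle.trans hδ))

/-- **The first comparison homeomorphism `ΦK` of `M`** (`= SK.Ψ`). [cite: Munkres1966, 10.2] -/
theorem exists_ΦK : ∃ Φ : M ≃ₜ M, (Φ : M → M) = I.SK.Ψ := by
  have hMqP : I.IK.Mq ⊆ I.IK.Prot := I.IK_Mq_subset.trans (I.P.MB_mono (by decide))
  have hMqV : I.IK.Mq ⊆ I.SK.V := hMqP.trans I.SK.prot_subset_V
  refine I.SK.exists_homeomorph_eq_Ψ hMqV ?_ hMqP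
  rintro _ ⟨q, hq, rfl⟩
  exact I.SK.prot_subset_V (I.SK_Ψ_mem (hMqV hq) (I.IK_Mq_subset hq))

/-- **The second comparison homeomorphism `ΦL` of `M`** (`= SL.Ψ`). [cite: Munkres1966, 10.2] -/
theorem exists_ΦL : ∃ Φ : M ≃ₜ M, (Φ : M → M) = I.SL.Ψ := by
  have hMqP : I.IL.Mq ⊆ I.IL.Prot := I.IL_Mq_subset.trans (I.P.MB_mono (by decide))
  have hMqV : I.IL.Mq ⊆ I.SL.V := hMqP.trans I.SL.prot_subset_V
  refine I.SL.exists_homeomorph_eq_Ψ hMqV ?_ hMqP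
  rintro _ ⟨q, hq, rfl⟩
  exact I.SL.prot_subset_V (I.SL_Ψ_mem (hMqV hq) (I.IL_Mq_subset hq))

/-- The first comparison homeomorphism. [folklore] -/
def ΦK : M ≃ₜ M := I.exists_ΦK.choose

/-- The second comparison homeomorphism. [folklore] -/
def ΦL : M ≃ₜ M := I.exists_ΦL.choose

/-- Auxiliary (`ΦK_apply`). [folklore] -/
theorem ΦK_apply (q : M) : I.ΦK q = I.SK.Ψ q := congr_fun I.exists_ΦK.choose_spec q

/-- Auxiliary (`ΦL_apply`). [folklore] -/
theorem ΦL_apply (q : M) : I.ΦL q = I.SL.Ψ q := congr_fun I.exists_ΦL.choose_spec q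

/-- `ΦK` is the identity off `MB 5`. [folklore] -/
theorem ΦK_eq_self {q : M} (hq : q ∉ I.P.MB 5) : I.ΦK q = q := by
  rw [ΦK_apply]; exact I.SK.Ψ_eq_self fun h => hq (I.IK_Mq_subset h)

/-- `ΦL` is the identity off `MB 5`. [folklore] -/
theorem ΦL_eq_self {q : M} (hq : q ∉ I.P.MB 5) : I.ΦL q = q := by
  rw [ΦL_apply]; exact I.SL.Ψ_eq_self fun h => hq (I.IL_Mq_subset h)

/-- `ΦK` maps `MB 5` into `MB 6`. [folklore] -/
theorem ΦK_mem {q : M} (hq : q ∈ I.P.MB 5) : I.ΦK q ∈ I.P.MB 6 := by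
  rw [ΦK_apply]
  exact I.SK_Ψ_mem (I.SK.prot_subset_V (I.P.MB_mono (by decide) hq)) hq

/-- `ΦL` maps `MB 5` into `MB 6`. [folklore] -/
theorem ΦL_mem {q : M} (hq : q ∈ I.P.MB 5) : I.ΦL q ∈ I.P.MB 6 := by
  rw [ΦL_apply]
  exact I.SL_Ψ_mem (I.SL.prot_subset_V (I.P.MB_mono (by decide) hq)) hq

/-- `ΦK` preserves every `MB ℓ`, `ℓ ≥ 6`, as a set. [folklore] -/
theorem ΦK_image_MB {ℓ : Fin 10} (hℓ : 6 ≤ ℓ) : I.ΦK '' I.P.MB ℓ = I.P.MB ℓ := by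
  have hsub : ∀ q ∈ I.P.MB ℓ, I.ΦK q ∈ I.P.MB ℓ := fun q hq => by
    by_cases h5 : q ∈ I.P.MB 5
    · exact I.P.MB_mono hℓ (I.ΦK_mem h5)
    · rw [I.ΦK_eq_self h5]; exact hq
  have hsub' : ∀ q, q ∉ I.P.MB ℓ → I.ΦK q ∉ I.P.MB ℓ := fun q hq => by
    have h5 : q ∉ I.P.MB 5 := fun h => hq (I.P.MB_mono ((show (5 : Fin 10) ≤ 6 by decide).trans hℓ) h)
    rw [I.ΦK_eq_self h5]; exact hq
  refine Subset.antisymm ?_ fun q hq => ?_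
  · rintro _ ⟨q, hq, rfl⟩; exact hsub q hq
  · refine ⟨I.ΦK.symm q, ?_, I.ΦK.apply_symm_apply q⟩
    by_contra h
    exact hsub' _ h (by rw [I.ΦK.apply_symm_apply]; exact hq)

/-- `ΦL` preserves every `MB ℓ`, `ℓ ≥ 6`, as a set. [folklore] -/
theorem ΦL_image_MB {ℓ : Fin 10} (hℓ : 6 ≤ ℓ) : I.ΦL '' I.P.MB ℓ = I.P.MB ℓ := by
  have hsub : ∀ q ∈ I.P.MB ℓ, I.ΦL q ∈ I.P.MB ℓ := fun q hq => by
    by_cases h5 : q ∈ I.P.MB 5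
    · exact I.P.MB_mono hℓ (I.ΦL_mem h5)
    · rw [I.ΦL_eq_self h5]; exact hq
  have hsub' : ∀ q, q ∉ I.P.MB ℓ → I.ΦL q ∉ I.P.MB ℓ := fun q hq => by
    have h5 : q ∉ I.P.MB 5 := fun h => hq (I.P.MB_mono ((show (5 : Fin 10) ≤ 6 by decide).trans hℓ) h)
    rw [I.ΦL_eq_self h5]; exact hq
  refine Subset.antisymm ?_ fun q hq => ?_
  · rintro _ ⟨q, hq, rfl⟩; exact hsub q hq
  · refine ⟨I.ΦL.symm q, ?_, I.ΦL.apply_symm_apply q⟩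
    by_contra h
    exact hsub' _ h (by rw [I.ΦL.apply_symm_apply]; exact hq)

/-- **Displacement of `ΦK` in the chart**: `≤ min ε γ`. [folklore] -/
theorem norm_ΦK_sub_le {q : M} (hq : q ∈ I.P.MB 5) :
    I.ΦK q ∈ I.P.ψ.source ∧ ‖I.P.ψ (I.ΦK q) - I.P.ψ q‖ ≤ I.εb := by
  rw [ΦK_apply]
  have hqV : q ∈ I.SK.V := I.SK.prot_subset_V (I.P.MB_mono (by decide) hq)
  obtain ⟨hs, hle⟩ := I.SK.norm_e_Ψ_sub_le hqV (I.P.MB_subset_source 5 hq)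
  exact ⟨hs, hle.trans I.SK.δ₀_le_εreq⟩

/-- **Displacement of `ΦL` in the chart**: `≤ min ε γ`. [folklore] -/
theorem norm_ΦL_sub_le {q : M} (hq : q ∈ I.P.MB 5) :
    I.ΦL q ∈ I.P.ψ.source ∧ ‖I.P.ψ (I.ΦL q) - I.P.ψ q‖ ≤ I.εb := by
  rw [ΦL_apply]
  have hqV : q ∈ I.SL.V := I.SL.prot_subset_V (I.P.MB_mono (by decide) hq)
  obtain ⟨hs, hle⟩ := I.SL.norm_e_Ψ_sub_le hqV (I.P.MB_subset_source 5 hq)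
  exact ⟨hs, hle.trans I.SL.δ₀_le_εreq⟩

/-- **The two comparison homeomorphisms agree on the image of the shared part.** [folklore] -/
theorem ΦK_eq_ΦL {q : M} (hq : q ∈ I.C.fK '' I.ShSp) : I.ΦK q = I.ΦL q := by
  rw [ΦK_apply, ΦL_apply]; exact I.Ψ_eq_Ψ hq

/-! #### The new maps -/

/-- The new first homeomorphism `F' = ΦK ∘ F`. [folklore] -/
def F' : M ≃ₜ M := I.F.trans I.ΦK

/-- The new second homeomorphism `G' = ΦL ∘ G`. [folklore] -/
def G' : M ≃ₜ M := I.G.trans I.ΦL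

/-- Auxiliary (`F'_apply`). [folklore] -/
theorem F'_apply (p : M) : I.F' p = I.ΦK (I.F p) := rfl

/-- Auxiliary (`G'_apply`). [folklore] -/
theorem G'_apply (p : M) : I.G' p = I.ΦL (I.G p) := rfl

/-- `F' = F` at points not mapped into `MB 5`. [folklore] -/
theorem F'_eq {p : M} (hp : I.F p ∉ I.P.MB 5) : I.F' p = I.F p := by
  rw [F'_apply, I.ΦK_eq_self hp]

/-- `G' = G` at points not mapped into `MB 5`. [folklore] -/
theorem G'_eq {p : M} (hp : I.G p ∉ I.P.MB 5) : I.G' p = I.G p := by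
  rw [G'_apply, I.ΦL_eq_self hp]

/-- The first coordinate sheet map is carried to the bent map: `F' ∘ e₁.symm ∘ realK = fbend`.
[folklore] -/
theorem F'_sheet {x : Fin I.C.N → ℝ} (hx : x ∈ I.C.PK.space) :
    I.F' (I.P.e₁.symm (real I.C.vtxK x)) = I.SK.fbend x := by
  rw [F'_apply, ΦK_apply]
  exact I.SK.Ψ_f hx

/-- The second coordinate sheet map is carried to the bent map. [folklore] -/
theorem G'_sheet {x : Fin I.C.N → ℝ} (hx : x ∈ I.C.PL.space) :
    I.G' (I.P.e₂.symm (real I.C.vtxL x)) = I.SL.fbend x := by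
  rw [G'_apply, ΦL_apply]
  exact I.SL.Ψ_f hx

/-! #### The new maps are PD along the PL structures -/

/-- The chart image `βK = ψ ∘ F' ∘ e₁.symm` of the new first map is PD on the interior of the
first sheet. [cite: Munkres1966, 10.2] -/
theorem isPDOn_βK : IsPDOn n (I.P.ψ ∘ I.F' ∘ I.P.e₁.symm) (interior I.T.K.space) := by
  have h := I.SK.isPDOn_transport (fun x hx => I.C.fK_mem_source hx) (real I.C.vtxK) I.C.injOn_realK
    (β := I.P.ψ ∘ I.F' ∘ I.P.e₁.symm) (fun x hx => by
      show I.P.ψ (I.F' (I.P.e₁.symm (real I.C.vtxK x))) = I.P.ψ (I.SK.fbend x)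
      rw [I.F'_sheet hx])
  rwa [show (I.IK.K.space : Set (Fin I.C.N → ℝ)) = I.C.PK.space from rfl, I.C.realK_space] at h

/-- The chart image `βL = ψ ∘ G' ∘ e₂.symm` of the new second map is PD on the interior of the
second sheet. [cite: Munkres1966, 10.2] -/
theorem isPDOn_βL : IsPDOn n (I.P.ψ ∘ I.G' ∘ I.P.e₂.symm) (interior I.T.L.space) := by
  have h := I.SL.isPDOn_transport (fun x hx => I.C.fL_mem_source hx) (real I.C.vtxL) I.C.injOn_realL
    (β := I.P.ψ ∘ I.G' ∘ I.P.e₂.symm) (fun x hx => by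
      show I.P.ψ (I.G' (I.P.e₂.symm (real I.C.vtxL x))) = I.P.ψ (I.SL.fbend x)
      rw [I.G'_sheet hx])
  rwa [show (I.IL.K.space : Set (Fin I.C.N → ℝ)) = I.C.PL.space from rfl, I.C.realL_space] at h

/-- Points whose `F`-image lies in `MB 8` are in `e₁.source` and are mapped by `e₁` into the
interior of the first sheet. [folklore] -/
theorem e₁_mem_interior {p : M} (hp : I.F p ∈ I.P.MB 8) :
    p ∈ I.P.e₁.source ∧ I.P.e₁ p ∈ interior I.T.K.space := by
  have hp9 : I.F p ∈ I.P.MB 9 := I.P.MB_mono (by decide) hp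
  obtain ⟨p', hp', hpp'⟩ := I.hdriftF hp9
  have hpe : p ∈ I.P.e₁.source := by rw [← I.F.injective hpp']; exact hp'
  refine ⟨hpe, ?_⟩
  set O' : Set M := I.P.e₁.source ∩ I.F ⁻¹' interior (I.F '' (I.P.e₁.symm '' I.T.K.space)) with hO'
  have hO'o : IsOpen O' := I.P.e₁.open_source.inter (isOpen_interior.preimage I.F.continuous)
  have hpO' : p ∈ O' := ⟨hpe, I.T.hKcov hp⟩
  have hsub : I.P.e₁ '' O' ⊆ I.T.K.space := by
    rintro _ ⟨q, ⟨hqe, hqF⟩, rfl⟩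
    obtain ⟨_, ⟨k, hk, rfl⟩, hkq⟩ := interior_subset hqF
    have hkt : k ∈ I.P.e₁.target := (I.T.hKU hk).1
    rw [← I.F.injective hkq, I.P.e₁.right_inv hkt]
    exact hk
  exact interior_maximal hsub (I.P.e₁.isOpen_image_of_subset_source hO'o inter_subset_left) ⟨p, hpO', rfl⟩

/-- The same for `G` and the second sheet. [folklore] -/
theorem e₂_mem_interior {p : M} (hp : I.G p ∈ I.P.MB 8) :
    p ∈ I.P.e₂.source ∧ I.P.e₂ p ∈ interior I.T.L.space := by
  have hp9 : I.G p ∈ I.P.MB 9 := I.P.MB_mono (by decide) hp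
  obtain ⟨p', hp', hpp'⟩ := I.hdriftG hp9
  have hpe : p ∈ I.P.e₂.source := by rw [← I.G.injective hpp']; exact hp'
  refine ⟨hpe, ?_⟩
  set O' : Set M := I.P.e₂.source ∩ I.G ⁻¹' interior (I.G '' (I.P.e₂.symm '' I.T.L.space)) with hO'
  have hO'o : IsOpen O' := I.P.e₂.open_source.inter (isOpen_interior.preimage I.G.continuous)
  have hpO' : p ∈ O' := ⟨hpe, I.T.hLcov hp⟩
  have hsub : I.P.e₂ '' O' ⊆ I.T.L.space := by
    rintro _ ⟨q, ⟨hqe, hqF⟩, rfl⟩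
    obtain ⟨_, ⟨k, hk, rfl⟩, hkq⟩ := interior_subset hqF
    have hkt : k ∈ I.P.e₂.target := (I.T.hLU hk).1
    rw [← I.G.injective hkq, I.P.e₂.right_inv hkt]
    exact hk
  exact interior_maximal hsub (I.P.e₂.isOpen_image_of_subset_source hO'o inter_subset_left) ⟨p, hpO', rfl⟩

variable (hcomp : IsPLOn.comp (n := n)) (haff : isPLOn_affineMap (n := n) (m := n))

/-- **Composition lemma**: a homeomorphism `H` of `M` which agrees with the PD-along map `F` at
points not mapped by `F` into `MB 5`, and whose chart image `ψ ∘ H ∘ e₀.symm` is PD on an open set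
`Ω` of `e₀`-coordinates containing `e₀ p` for every `p` with `F p ∈ MB 5` (where `H p ∈ ψ.source`),
is PD along `(c, cD)` — for `e₀` a chart of the PL atlas `c`. [cite: Munkres1966, 10.2] -/
theorem pdAlong_of_local {c : ChartedSpace (𝔼 n) M} (hD : @IsManifold _ _ _ _ _ _ _ (𝓡 n) ∞ M _ cD)
    (hc : @IsPLManifold n hcomp haff M _ c) {F H : M ≃ₜ M} (hF : PDAlong n c cD F)
    {e₀ : OpenPartialHomeomorph M (𝔼 n)} (he₀ : e₀ ∈ @atlas (𝔼 n) _ M _ c)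
    (heq : ∀ p, F p ∉ I.P.MB 5 → H p = F p) {Ω : Set (𝔼 n)} (hΩ : IsOpen Ω)
    (hPD : IsPDOn n (I.P.ψ ∘ H ∘ e₀.symm) Ω) (hΩt : Ω ⊆ e₀.target)
    (hmem : ∀ p, F p ∈ I.P.MB 5 → p ∈ e₀.source ∧ e₀ p ∈ Ω ∧ H p ∈ I.P.ψ.source) :
    PDAlong n c cD H := by
  refine ⟨fun e he e' he' => IsPDOn.of_forall_exists fun x hx => ?_⟩
  obtain ⟨hxt, hxe'⟩ := hx
  set p : M := e.symm x with hp
  by_cases h5 : F p ∈ I.P.MB 5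
  · -- near the sheet: compose `(e' ∘ ψ.symm) ∘ (ψ ∘ H ∘ e₀.symm) ∘ (e₀ ∘ e.symm)`
    obtain ⟨hpe₀, hpΩ, hHψ⟩ := hmem p h5
    -- step 1: restrict `Ω` to where `H ∘ e₀.symm` maps into `ψ.source`
    set Ω' : Set (𝔼 n) := Ω ∩ e₀.symm ⁻¹' (H ⁻¹' I.P.ψ.source) with hΩ'
    have hΩ'o : IsOpen Ω' := by
      have h1 := e₀.symm.isOpen_inter_preimage (I.P.ψ.open_source.preimage H.continuous)
      rw [e₀.symm_source] at h1
      have : Ω' = Ω ∩ (e₀.target ∩ e₀.symm ⁻¹' (H ⁻¹' I.P.ψ.source)) := by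
        rw [hΩ', ← inter_assoc, inter_eq_left.2 hΩt]
      rw [this]; exact hΩ.inter h1
    have hPD' : IsPDOn n (I.P.ψ ∘ H ∘ e₀.symm) Ω' := hPD.mono hΩ'o inter_subset_left
    -- step 2: post-compose with the smooth transition `ψ.symm ≫ e'`
    obtain ⟨hTs, hTinj⟩ := @transition_smooth n M _ _ cD hD _ _ I.P.hψ he'
    set w₂ : Set (𝔼 n) := Ω' ∩ (I.P.ψ ∘ H ∘ e₀.symm) ⁻¹' (I.P.ψ.symm ≫ₕ e').source with hw₂
    have hw₂o : IsOpen w₂ := hPD'.continuousOn.isOpen_inter_preimage hΩ'o (I.P.ψ.symm ≫ₕ e').open_source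
    have hPD₂ : IsPDOn n ((I.P.ψ.symm ≫ₕ e') ∘ (I.P.ψ ∘ H ∘ e₀.symm)) w₂ :=
      hPD'.contDiffOn_comp (I.P.ψ.symm ≫ₕ e').open_source hTs hTinj hw₂o inter_subset_left
        fun y hy => hy.2
    -- step 3: pre-compose with the PL transition `e.symm ≫ e₀`
    have hmemG := (mem_plGroupoid_iff n hcomp haff).1
      (@IsPLManifold.compatible_of_mem_atlas n hcomp haff M _ c hc e e₀ he he₀)
    set u₀ : Set (𝔼 n) := (e.symm ≫ₕ e₀).source with hu₀
    have hPL₀ : IsPLOn n n (e.symm ≫ₕ e₀) u₀ := hmemG.1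
    have hPD₃ : IsPDOn n (((I.P.ψ.symm ≫ₕ e') ∘ (I.P.ψ ∘ H ∘ e₀.symm)) ∘ (e.symm ≫ₕ e₀))
        (u₀ ∩ (e.symm ≫ₕ e₀) ⁻¹' w₂) :=
      hPD₂.comp_isPLOn hPL₀ (e.symm ≫ₕ e₀).open_source (e.symm ≫ₕ e₀).injOn
    -- the set `u₃`
    set u₃ : Set (𝔼 n) := u₀ ∩ (e.symm ≫ₕ e₀) ⁻¹' w₂ with hu₃
    have hval : ∀ y ∈ u₃, e.symm y ∈ e₀.source ∧ H (e.symm y) ∈ I.P.ψ.source ∧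
        (((I.P.ψ.symm ≫ₕ e') ∘ (I.P.ψ ∘ H ∘ e₀.symm)) ∘ (e.symm ≫ₕ e₀)) y = e' (H (e.symm y)) ∧
        H (e.symm y) ∈ e'.source := by
      intro y hy
      have hy₀ : e.symm y ∈ e₀.source := by
        have := hy.1; rw [hu₀, OpenPartialHomeomorph.trans_source] at this; exact this.2
      have hyw : e₀ (e.symm y) ∈ w₂ := hy.2
      have hyΩ' : e₀ (e.symm y) ∈ Ω' := hyw.1
      have hHs : H (e.symm y) ∈ I.P.ψ.source := by
        have := hyΩ'.2; simp only [mem_preimage, e₀.left_inv hy₀] at this; exact this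
      have hsrc2 := hyw.2
      simp only [mem_preimage, Function.comp_apply, OpenPartialHomeomorph.trans_source,
        OpenPartialHomeomorph.symm_source, mem_inter_iff, e₀.left_inv hy₀] at hsrc2
      have he's : H (e.symm y) ∈ e'.source := by
        have := hsrc2.2; rwa [I.P.ψ.left_inv hHs] at this
      refine ⟨hy₀, hHs, ?_, he's⟩
      show (I.P.ψ.symm ≫ₕ e') (I.P.ψ (H (e₀.symm (e₀ (e.symm y))))) = e' (H (e.symm y))
      rw [e₀.left_inv hy₀, OpenPartialHomeomorph.trans_apply, I.P.ψ.left_inv hHs]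
    refine ⟨u₃, fun y hy => ⟨?_, ?_⟩, ?_, ?_⟩
    · have := hy.1; rw [hu₀, OpenPartialHomeomorph.trans_source] at this; exact this.1
    · exact (hval y hy).2.2.2
    · -- `x ∈ u₃`
      refine ⟨?_, ?_⟩
      · rw [hu₀, OpenPartialHomeomorph.trans_source]; exact ⟨hxt, hpe₀⟩
      · show e₀ (e.symm x) ∈ w₂
        refine ⟨⟨hpΩ, ?_⟩, ?_⟩
        · show H (e₀.symm (e₀ p)) ∈ I.P.ψ.source
          rw [e₀.left_inv hpe₀]; exact hHψ
        · show I.P.ψ (H (e₀.symm (e₀ p))) ∈ (I.P.ψ.symm ≫ₕ e').source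
          rw [e₀.left_inv hpe₀, OpenPartialHomeomorph.trans_source, I.P.ψ.symm_source, mem_inter_iff,
            mem_preimage, I.P.ψ.left_inv hHψ]
          exact ⟨I.P.ψ.map_source hHψ, hxe'⟩
    · exact IsPDOn.congr (fun y hy => ((hval y hy).2.2.1).symm) hPD₃
  · -- far from the sheet: `H = F` near `p`
    set U : Set M := {q | F q ∉ I.P.MB 5} with hU
    have hUo : IsOpen U := (I.P.isCompact_MB 5).isClosed.isOpen_compl.preimage F.continuous
    set v : Set (𝔼 n) := e.target ∩ e.symm ⁻¹' (F ⁻¹' e'.source ∩ U) with hv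
    have hvo : IsOpen v := by
      have h1 := e.symm.isOpen_inter_preimage ((e'.open_source.preimage F.continuous).inter hUo)
      rwa [e.symm_source] at h1
    have hF' := hF.isPDOn e he e' he'
    have h1 : IsPDOn n (e' ∘ F ∘ e.symm) v := hF'.mono hvo fun y hy => ⟨hy.1, hy.2.1⟩
    have h2 : IsPDOn n (e' ∘ H ∘ e.symm) v :=
      IsPDOn.congr (fun y hy => by show e' (H (e.symm y)) = e' (F (e.symm y)); rw [heq _ hy.2.2]) h1
    refine ⟨v, fun y hy => ⟨hy.1, ?_⟩, ⟨hxt, ?_, h5⟩, h2⟩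
    · show H (e.symm y) ∈ e'.source
      rw [heq _ hy.2.2]; exact hy.2.1
    · show F (e.symm x) ∈ e'.source
      rw [← heq _ h5]; exact hxe'

/-- **`F'` is PD along `(c₁, cD)`.** [cite: Munkres1966, 10.2 and Thm 10.5] -/
theorem pdAlong_F' (hD : @IsManifold _ _ _ _ _ _ _ (𝓡 n) ∞ M _ cD)
    (h₁ : @IsPLManifold n hcomp haff M _ c₁) : PDAlong n c₁ cD I.F' :=
  I.pdAlong_of_local hcomp haff hD h₁ I.hF I.P.he₁ (fun _ hp => I.F'_eq hp) isOpen_interior I.isPDOn_βK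
    (interior_subset.trans fun y hy => (I.T.hKU hy).1) fun p hp =>
      ⟨(I.e₁_mem_interior (I.P.MB_mono (by decide) hp)).1, (I.e₁_mem_interior (I.P.MB_mono (by decide) hp)).2,
        I.P.MB_subset_source 6 (by rw [F'_apply]; exact I.ΦK_mem hp)⟩

/-- **`G'` is PD along `(c₂, cD)`.** [cite: Munkres1966, 10.2 and Thm 10.5] -/
theorem pdAlong_G' (hD : @IsManifold _ _ _ _ _ _ _ (𝓡 n) ∞ M _ cD)
    (h₂ : @IsPLManifold n hcomp haff M _ c₂) : PDAlong n c₂ cD I.G' :=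
  I.pdAlong_of_local hcomp haff hD h₂ I.hG I.P.he₂ (fun _ hp => I.G'_eq hp) isOpen_interior I.isPDOn_βL
    (interior_subset.trans fun y hy => (I.T.hLU hy).1) fun p hp =>
      ⟨(I.e₂_mem_interior (I.P.MB_mono (by decide) hp)).1, (I.e₂_mem_interior (I.P.MB_mono (by decide) hp)).2,
        I.P.MB_subset_source 6 (by rw [G'_apply]; exact I.ΦL_mem hp)⟩

/-! #### PL-ness: a chart-level criterion -/

/-- **`PLAlongOn` from one pair of charts.** If `κ = e₀' ∘ h ∘ e₀.symm` is PL on an open set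
`Wc ⊆ e₀.target` (for charts `e₀` of `c` and `e₀'` of `c'`, PL atlases), then `h` is PL along
`(c, c')` over every open set `U` whose points `p` satisfy `p ∈ e₀.source`, `e₀ p ∈ Wc`,
`h p ∈ e₀'.source` (compose with the PL chart transitions, `IsPLOn.comp`). [folklore] -/
theorem plAlongOn_of_chart {c c' : ChartedSpace (𝔼 n) M} (hc : @IsPLManifold n hcomp haff M _ c)
    (hc' : @IsPLManifold n hcomp haff M _ c') {h : M ≃ₜ M}
    {e₀ : OpenPartialHomeomorph M (𝔼 n)} (he₀ : e₀ ∈ @atlas (𝔼 n) _ M _ c)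
    {e₀' : OpenPartialHomeomorph M (𝔼 n)} (he₀' : e₀' ∈ @atlas (𝔼 n) _ M _ c')
    {Wc : Set (𝔼 n)} (hWc : IsOpen Wc) (hκ : IsPLOn n n (e₀' ∘ h ∘ e₀.symm) Wc) (hWct : Wc ⊆ e₀.target)
    {U : Set M} (hUo : IsOpen U) (hU : ∀ p ∈ U, p ∈ e₀.source ∧ e₀ p ∈ Wc ∧ h p ∈ e₀'.source) :
    PLAlongOn n c c' h U := by
  refine ⟨fun e he e' he' => IsPLOn.of_forall_exists fun x hx => ?_⟩
  obtain ⟨hxt, hxU, hxe'⟩ := hx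
  set p : M := e.symm x with hp
  obtain ⟨hpe₀, hpW, hhp⟩ := hU p hxU
  -- restrict `Wc` to where `h ∘ e₀.symm` maps into `e₀'.source`
  set W' : Set (𝔼 n) := Wc ∩ e₀.symm ⁻¹' (h ⁻¹' e₀'.source) with hW'
  have hW'o : IsOpen W' := by
    have h1 := e₀.symm.isOpen_inter_preimage (e₀'.open_source.preimage h.continuous)
    rw [e₀.symm_source] at h1
    have : W' = Wc ∩ (e₀.target ∩ e₀.symm ⁻¹' (h ⁻¹' e₀'.source)) := by
      rw [hW', ← inter_assoc, inter_eq_left.2 hWct]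
    rw [this]; exact hWc.inter h1
  have hκ' : IsPLOn n n (e₀' ∘ h ∘ e₀.symm) W' := IsPLOn.mono_holds hκ hW'o inter_subset_left
  -- post-compose with `e₀'.symm ≫ e'`
  have hmem₂ := (mem_plGroupoid_iff n hcomp haff).1
    (@IsPLManifold.compatible_of_mem_atlas n hcomp haff M _ c' hc' e₀' e' he₀' he')
  set t₂ := e₀'.symm ≫ₕ e' with ht₂
  have hw : IsOpen (W' ∩ (e₀' ∘ h ∘ e₀.symm) ⁻¹' t₂.source) :=
    hκ'.continuousOn.isOpen_inter_preimage hW'o t₂.open_source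
  have h₂ : IsPLOn n n (t₂ ∘ (e₀' ∘ h ∘ e₀.symm)) (W' ∩ (e₀' ∘ h ∘ e₀.symm) ⁻¹' t₂.source) :=
    hcomp hκ' hmem₂.1 hW'o t₂.open_source hw
  -- pre-compose with `e.symm ≫ e₀`
  have hmem₁ := (mem_plGroupoid_iff n hcomp haff).1
    (@IsPLManifold.compatible_of_mem_atlas n hcomp haff M _ c hc e e₀ he he₀)
  set t₁ := e.symm ≫ₕ e₀ with ht₁
  set w := W' ∩ (e₀' ∘ h ∘ e₀.symm) ⁻¹' t₂.source with hwdef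
  have hu₃o : IsOpen (t₁.source ∩ t₁ ⁻¹' w) := t₁.continuousOn.isOpen_inter_preimage t₁.open_source hw
  have h₃ : IsPLOn n n ((t₂ ∘ (e₀' ∘ h ∘ e₀.symm)) ∘ t₁) (t₁.source ∩ t₁ ⁻¹' w) :=
    hcomp hmem₁.1 h₂ t₁.open_source hw hu₃o
  -- intersect with `e.symm ⁻¹' U`
  set u₃ : Set (𝔼 n) := t₁.source ∩ t₁ ⁻¹' w ∩ e.symm ⁻¹' U with hu₃
  have hu₃o' : IsOpen u₃ := by
    have h1 := e.symm.isOpen_inter_preimage hUo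
    rw [e.symm_source] at h1
    have : u₃ = t₁.source ∩ t₁ ⁻¹' w ∩ (e.target ∩ e.symm ⁻¹' U) := by
      rw [hu₃]
      ext y; constructor
      · rintro ⟨hy, hyU⟩
        have : y ∈ e.target := by
          have := hy.1; rw [ht₁, OpenPartialHomeomorph.trans_source] at this; exact this.1
        exact ⟨hy, this, hyU⟩
      · rintro ⟨hy, -, hyU⟩; exact ⟨hy, hyU⟩
    rw [this]; exact hu₃o.inter h1
  have h₄ : IsPLOn n n ((t₂ ∘ (e₀' ∘ h ∘ e₀.symm)) ∘ t₁) u₃ := IsPLOn.mono_holds h₃ hu₃o' inter_subset_left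
  have hval : ∀ y ∈ u₃, y ∈ e.target ∧ e.symm y ∈ e₀.source ∧ h (e.symm y) ∈ e₀'.source ∧
      h (e.symm y) ∈ e'.source ∧ ((t₂ ∘ (e₀' ∘ h ∘ e₀.symm)) ∘ t₁) y = e' (h (e.symm y)) := by
    intro y hy
    have hy₁ := hy.1.1
    rw [ht₁, OpenPartialHomeomorph.trans_source] at hy₁
    obtain ⟨hyt, hy₀⟩ := hy₁
    have hyw : t₁ y ∈ w := hy.1.2
    have ht₁y : t₁ y = e₀ (e.symm y) := rfl
    rw [ht₁y] at hyw
    obtain ⟨⟨-, hyh⟩, hy₂⟩ := hyw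
    have hyh' : h (e.symm y) ∈ e₀'.source := by
      simp only [mem_preimage, e₀.left_inv hy₀] at hyh; exact hyh
    simp only [mem_preimage, Function.comp_apply, e₀.left_inv hy₀, ht₂, OpenPartialHomeomorph.trans_source,
      OpenPartialHomeomorph.symm_source, mem_inter_iff, e₀'.left_inv hyh'] at hy₂
    refine ⟨hyt, hy₀, hyh', hy₂.2, ?_⟩
    show t₂ (e₀' (h (e₀.symm (e₀ (e.symm y))))) = e' (h (e.symm y))
    rw [e₀.left_inv hy₀, ht₂, OpenPartialHomeomorph.trans_apply, e₀'.left_inv hyh']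
  refine ⟨u₃, fun y hy => ⟨(hval y hy).1, hy.2, (hval y hy).2.2.2.1⟩, ?_, ?_⟩
  · -- `x ∈ u₃`
    refine ⟨⟨?_, ?_⟩, hxU⟩
    · rw [ht₁, OpenPartialHomeomorph.trans_source]; exact ⟨hxt, hpe₀⟩
    · show e₀ (e.symm x) ∈ w
      refine ⟨⟨hpW, ?_⟩, ?_⟩
      · show h (e₀.symm (e₀ p)) ∈ e₀'.source
        rw [e₀.left_inv hpe₀]; exact hhp
      · show e₀' (h (e₀.symm (e₀ p))) ∈ t₂.source
        rw [e₀.left_inv hpe₀, ht₂, OpenPartialHomeomorph.trans_source, e₀'.symm_source, mem_inter_iff,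
          mem_preimage, e₀'.left_inv hhp]
        exact ⟨e₀'.map_source hhp, hxe'⟩
  · exact h₄.congr hu₃o' fun y hy => ((hval y hy).2.2.2.2).symm

/-! #### PL-ness: the region where the two comparison maps agree -/

/-- The open set of `M` on which `ΦK = ΦL` (the interior of the second sheet's image minus the
images of the non-shared simplices). [folklore] -/
def Ob : Set M := interior (I.C.fL '' I.C.PL.space) \
  ⋃ τ ∈ {τ | τ ∈ I.C.PL.faces ∧ τ ∉ I.C.ShC}, I.C.fL '' convexHull ℝ (τ : Set (Fin I.C.N → ℝ))

/-- The open set of `M` on which `ΦK = ΦL`, seen from the first sheet. [folklore] -/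
def Ob' : Set M := interior (I.C.fK '' I.C.PK.space) \
  ⋃ τ ∈ {τ | τ ∈ I.C.PK.faces ∧ τ ∉ I.C.ShC}, I.C.fK '' convexHull ℝ (τ : Set (Fin I.C.N → ℝ))

/-- Auxiliary (`isOpen_Ob`). [folklore] -/
theorem isOpen_Ob : IsOpen I.Ob := by
  refine isOpen_interior.sdiff ((I.C.PL_finite.subset fun τ (h : τ ∈ I.C.PL.faces ∧ τ ∉ I.C.ShC) =>
    h.1).isClosed_biUnion fun τ hτ => ?_)
  exact ((τ.finite_toSet.isCompact_convexHull (𝕜 := ℝ)).image_of_continuousOn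
    (I.C.continuousOn_fL hτ.1)).isClosed

/-- Auxiliary (`isOpen_Ob'`). [folklore] -/
theorem isOpen_Ob' : IsOpen I.Ob' := by
  refine isOpen_interior.sdiff ((I.C.PK_finite.subset fun τ (h : τ ∈ I.C.PK.faces ∧ τ ∉ I.C.ShC) =>
    h.1).isClosed_biUnion fun τ hτ => ?_)
  exact ((τ.finite_toSet.isCompact_convexHull (𝕜 := ℝ)).image_of_continuousOn
    (I.C.continuousOn_fK hτ.1)).isClosed

/-- `Ob` lies in the image of the shared part. [folklore] -/
theorem Ob_subset : I.Ob ⊆ I.C.fK '' I.ShSp := by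
  rintro q ⟨hq, hqn⟩
  obtain ⟨x, hx, rfl⟩ := interior_subset hq
  obtain ⟨τ, hτ, hxτ⟩ := Geometry.SimplicialComplex.mem_space_iff.1 hx
  have hτsh : τ ∈ I.C.ShC := by
    by_contra hτsh
    exact hqn (mem_iUnion₂.2 ⟨τ, ⟨hτ, hτsh⟩, x, hxτ, rfl⟩)
  exact ⟨x, mem_iUnion₂.2 ⟨τ, hτsh, hxτ⟩, I.C.fK_eq_fL hτsh hxτ⟩

/-- `Ob'` lies in the image of the shared part. [folklore] -/
theorem Ob'_subset : I.Ob' ⊆ I.C.fK '' I.ShSp := by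
  rintro q ⟨hq, hqn⟩
  obtain ⟨x, hx, rfl⟩ := interior_subset hq
  obtain ⟨τ, hτ, hxτ⟩ := Geometry.SimplicialComplex.mem_space_iff.1 hx
  have hτsh : τ ∈ I.C.ShC := by
    by_contra hτsh
    exact hqn (mem_iUnion₂.2 ⟨τ, ⟨hτ, hτsh⟩, x, hxτ, rfl⟩)
  exact ⟨x, mem_iUnion₂.2 ⟨τ, hτsh, hxτ⟩, rfl⟩

/-- `Zc ⊆ Ob`. [folklore] -/
theorem Zc_subset_Ob : I.Zc ⊆ I.Ob := by
  intro q hq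
  have hq8 : q ∈ I.P.MB 8 := I.P.MB_mono (by decide) hq.1
  refine ⟨?_, fun hqU => ?_⟩
  · rw [fL_image]; exact I.T.hLcov hq8
  · obtain ⟨τ, ⟨hτL, hτsh⟩, x, hxτ, hxq⟩ := mem_iUnion₂.1 hqU
    exact hτsh (I.C.shC_of_mem_PL hτL ⟨x, hxτ, by rw [hxq]; exact hq⟩)

/-- `Zc ⊆ Ob'`. [folklore] -/
theorem Zc_subset_Ob' : I.Zc ⊆ I.Ob' := by
  intro q hq
  have hq8 : q ∈ I.P.MB 8 := I.P.MB_mono (by decide) hq.1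
  refine ⟨?_, fun hqU => ?_⟩
  · rw [fK_image]; exact I.T.hKcov hq8
  · obtain ⟨τ, ⟨hτK, hτsh⟩, x, hxτ, hxq⟩ := mem_iUnion₂.1 hqU
    exact hτsh (I.C.shC_of_mem_PK hτK ⟨x, hxτ, by rw [hxq]; exact hq⟩)

/-- `ΦK = ΦL` on `Ob`. [folklore] -/
theorem ΦK_eq_ΦL_of_mem_Ob {q : M} (hq : q ∈ I.Ob) : I.ΦK q = I.ΦL q := I.ΦK_eq_ΦL (I.Ob_subset hq)

/-- `ΦK = ΦL` on `Ob'`. [folklore] -/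
theorem ΦK_eq_ΦL_of_mem_Ob' {q : M} (hq : q ∈ I.Ob') : I.ΦK q = I.ΦL q := I.ΦK_eq_ΦL (I.Ob'_subset hq)

/-- **The collar argument**: a point of `MB 5` moved by `ΦL` (or `ΦK`) into `Am` was in `Acl`,
hence in `Zc`. [folklore] -/
theorem mem_Zc_of_ΦL_mem {q : M} (hq : q ∈ I.P.MB 5) (hq' : I.ΦL q ∈ I.Am) : q ∈ I.Zc := by
  obtain ⟨hs, hle⟩ := I.norm_ΦL_sub_le hq
  refine ⟨hq, I.hmargin q (I.P.MB_subset_source 5 hq) _ hs ((I.P.mem_MB_iff.1 (I.P.MB_mono (by decide) hq)).2)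
    (hle.trans (min_le_right _ _)) hq'⟩

/-- The same for `ΦK`. [folklore] -/
theorem mem_Zc_of_ΦK_mem {q : M} (hq : q ∈ I.P.MB 5) (hq' : I.ΦK q ∈ I.Am) : q ∈ I.Zc := by
  obtain ⟨hs, hle⟩ := I.norm_ΦK_sub_le hq
  refine ⟨hq, I.hmargin q (I.P.MB_subset_source 5 hq) _ hs ((I.P.mem_MB_iff.1 (I.P.MB_mono (by decide) hq)).2)
    (hle.trans (min_le_right _ _)) hq'⟩

/-- The old comparison homeomorphism `h = F⁻¹ ∘ G`. [folklore] -/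
def h : M ≃ₜ M := I.G.trans I.F.symm

/-- The new comparison homeomorphism `h' = F'⁻¹ ∘ G'`. [folklore] -/
def h' : M ≃ₜ M := I.G'.trans I.F'.symm

/-- Auxiliary (`h_apply`). [folklore] -/
theorem h_apply (p : M) : I.h p = I.F.symm (I.G p) := rfl

/-- Auxiliary (`h'_apply`). [folklore] -/
theorem h'_apply (p : M) : I.h' p = I.F.symm (I.ΦK.symm (I.ΦL (I.G p))) := rfl

/-- Auxiliary (`h_symm_apply`). [folklore] -/
theorem h_symm_apply (p : M) : I.h.symm p = I.G.symm (I.F p) := rfl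

/-- Auxiliary (`h'_symm_apply`). [folklore] -/
theorem h'_symm_apply (p : M) : I.h'.symm p = I.G.symm (I.ΦL.symm (I.ΦK (I.F p))) := rfl

/-- `h' = h` where `G` does not map into `MB 5`. [folklore] -/
theorem h'_eq_h_far {p : M} (hp : I.G p ∉ I.P.MB 5) : I.h' p = I.h p := by
  rw [h'_apply, h_apply, I.ΦL_eq_self hp]
  congr 1
  rw [Homeomorph.symm_apply_eq]
  exact (I.ΦK_eq_self hp).symm

/-- `h' = h` where `G` maps into `Ob`. [folklore] -/
theorem h'_eq_h_Ob {p : M} (hp : I.G p ∈ I.Ob) : I.h' p = I.h p := by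
  rw [h'_apply, h_apply, ← I.ΦK_eq_ΦL_of_mem_Ob hp, Homeomorph.symm_apply_apply]

/-- `h'.symm = h.symm` where `F` does not map into `MB 5`. [folklore] -/
theorem h'_symm_eq_far {p : M} (hp : I.F p ∉ I.P.MB 5) : I.h'.symm p = I.h.symm p := by
  rw [h'_symm_apply, h_symm_apply, I.ΦK_eq_self hp]
  congr 1
  rw [Homeomorph.symm_apply_eq]
  exact (I.ΦL_eq_self hp).symm

/-- `h'.symm = h.symm` where `F` maps into `Ob'`. [folklore] -/
theorem h'_symm_eq_Ob' {p : M} (hp : I.F p ∈ I.Ob') : I.h'.symm p = I.h.symm p := by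
  rw [h'_symm_apply, h_symm_apply, I.ΦK_eq_ΦL_of_mem_Ob' hp, Homeomorph.symm_apply_apply]

/-! #### PL-ness: the straight parts -/

/-- The chart image of the new first map. [folklore] -/
def βK : 𝔼 n → 𝔼 n := I.P.ψ ∘ I.F' ∘ I.P.e₁.symm

/-- The chart image of the new second map. [folklore] -/
def βL : 𝔼 n → 𝔼 n := I.P.ψ ∘ I.G' ∘ I.P.e₂.symm

/-- Auxiliary (`βK_apply`). [folklore] -/
theorem βK_apply (y : 𝔼 n) : I.βK y = I.P.ψ (I.F' (I.P.e₁.symm y)) := rfl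

/-- Auxiliary (`βL_apply`). [folklore] -/
theorem βL_apply (y : 𝔼 n) : I.βL y = I.P.ψ (I.G' (I.P.e₂.symm y)) := rfl

/-- The straight simplices of the first refinement (those in the zone of `R₂ = B 3`). [folklore] -/
def StrK : Set (Finset (Fin I.C.N → ℝ)) :=
  {t | t ∈ I.SK.P.faces ∧ convexHull ℝ (t : Set (Fin I.C.N → ℝ)) ⊆ zone I.C.PK I.C.fK I.P.ψ (I.P.B 3)}

/-- The straight simplices of the second refinement. [folklore] -/
def StrL : Set (Finset (Fin I.C.N → ℝ)) :=
  {t | t ∈ I.SL.P.faces ∧ convexHull ℝ (t : Set (Fin I.C.N → ℝ)) ⊆ zone I.C.PL I.C.fL I.P.ψ (I.P.B 3)}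

/-- Auxiliary (`strK_down`). [folklore] -/
theorem strK_down : ∀ s ∈ I.StrK, ∀ t ⊆ s, t.Nonempty → t ∈ I.StrK := fun s hs t hts hne =>
  ⟨I.SK.P.down_closed hs.1 hts hne, (convexHull_mono (by exact_mod_cast hts)).trans hs.2⟩

/-- Auxiliary (`strL_down`). [folklore] -/
theorem strL_down : ∀ s ∈ I.StrL, ∀ t ⊆ s, t.Nonempty → t ∈ I.StrL := fun s hs t hts hne =>
  ⟨I.SL.P.down_closed hs.1 hts hne, (convexHull_mono (by exact_mod_cast hts)).trans hs.2⟩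

/-- The straight subcomplex of the first refinement. [folklore] -/
def PStrK : Geometry.SimplicialComplex ℝ (Fin I.C.N → ℝ) :=
  subcomplexOf I.SK.P I.StrK (fun _ h => h.1) I.strK_down

/-- The straight subcomplex of the second refinement. [folklore] -/
def PStrL : Geometry.SimplicialComplex ℝ (Fin I.C.N → ℝ) :=
  subcomplexOf I.SL.P I.StrL (fun _ h => h.1) I.strL_down

/-- On a straight simplex of the first refinement, `F' ∘ e₁.symm ∘ realK` is the affine secant map
in the chart. [cite: Munkres1966, 10.2] -/
theorem straightK {t : Finset (Fin I.C.N → ℝ)} (ht : t ∈ I.StrK) {x : Fin I.C.N → ℝ}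
    (hx : x ∈ convexHull ℝ (t : Set (Fin I.C.N → ℝ))) :
    I.F' (I.P.e₁.symm (real I.C.vtxK x)) ∈ I.P.ψ.source ∧ I.βK (real I.C.vtxK x) = I.SK.A t ht.1 x := by
  have hxK : x ∈ I.C.PK.space := I.SK.P_space ▸ I.SK.P.convexHull_subset_space ht.1 hx
  obtain ⟨hsrc, heq, -⟩ := I.SK.straight ht.1 ht.2 hx
  rw [βK_apply, I.F'_sheet hxK]
  exact ⟨hsrc, heq⟩

/-- The same for the second refinement. [cite: Munkres1966, 10.2] -/
theorem straightL {t : Finset (Fin I.C.N → ℝ)} (ht : t ∈ I.StrL) {x : Fin I.C.N → ℝ}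
    (hx : x ∈ convexHull ℝ (t : Set (Fin I.C.N → ℝ))) :
    I.G' (I.P.e₂.symm (real I.C.vtxL x)) ∈ I.P.ψ.source ∧ I.βL (real I.C.vtxL x) = I.SL.A t ht.1 x := by
  have hxL : x ∈ I.C.PL.space := I.SL.P_space ▸ I.SL.P.convexHull_subset_space ht.1 hx
  obtain ⟨hsrc, heq, -⟩ := I.SL.straight ht.1 ht.2 hx
  rw [βL_apply, I.G'_sheet hxL]
  exact ⟨hsrc, heq⟩

/-- **The straight complex `QK`** in `e₁`-coordinates: the image of the straight subcomplex of the
first refinement under `realK`. [folklore] -/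
theorem exists_QK : ∃ Q : Geometry.SimplicialComplex ℝ (𝔼 n),
    (∀ τ, τ ∈ Q.faces ↔ ∃ t ∈ I.StrK, t.image (real I.C.vtxK) = τ) ∧
    ∀ t ∈ I.StrK, convexHull ℝ ((t.image (real I.C.vtxK) : Finset (𝔼 n)) : Set (𝔼 n)) =
      real I.C.vtxK '' convexHull ℝ (t : Set (Fin I.C.N → ℝ)) := by
  classical
  exact exists_simplicialComplex_image I.PStrK (real I.C.vtxK)
    (fun _ _ => ⟨(real I.C.vtxK).toAffineMap, fun _ _ => rfl⟩)
    (I.C.injOn_realK.mono fun x hx => by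
      obtain ⟨t, ht, hxt⟩ := Geometry.SimplicialComplex.mem_space_iff.1 hx
      exact I.SK.P_space ▸ I.SK.P.convexHull_subset_space (show t ∈ I.StrK from ht).1 hxt)

/-- **The straight complex `QL`** in `e₂`-coordinates. [folklore] -/
theorem exists_QL : ∃ Q : Geometry.SimplicialComplex ℝ (𝔼 n),
    (∀ τ, τ ∈ Q.faces ↔ ∃ t ∈ I.StrL, t.image (real I.C.vtxL) = τ) ∧
    ∀ t ∈ I.StrL, convexHull ℝ ((t.image (real I.C.vtxL) : Finset (𝔼 n)) : Set (𝔼 n)) =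
      real I.C.vtxL '' convexHull ℝ (t : Set (Fin I.C.N → ℝ)) := by
  classical
  exact exists_simplicialComplex_image I.PStrL (real I.C.vtxL)
    (fun _ _ => ⟨(real I.C.vtxL).toAffineMap, fun _ _ => rfl⟩)
    (I.C.injOn_realL.mono fun x hx => by
      obtain ⟨t, ht, hxt⟩ := Geometry.SimplicialComplex.mem_space_iff.1 hx
      exact I.SL.P_space ▸ I.SL.P.convexHull_subset_space (show t ∈ I.StrL from ht).1 hxt)

/-- The straight complex in `e₁`-coordinates. [folklore] -/
def QK : Geometry.SimplicialComplex ℝ (𝔼 n) := I.exists_QK.choose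

/-- The straight complex in `e₂`-coordinates. [folklore] -/
def QL : Geometry.SimplicialComplex ℝ (𝔼 n) := I.exists_QL.choose

/-- Auxiliary (`QK_faces`). [folklore] -/
theorem QK_faces {τ : Finset (𝔼 n)} : τ ∈ I.QK.faces ↔ ∃ t ∈ I.StrK, t.image (real I.C.vtxK) = τ :=
  I.exists_QK.choose_spec.1 τ

/-- Auxiliary (`QL_faces`). [folklore] -/
theorem QL_faces {τ : Finset (𝔼 n)} : τ ∈ I.QL.faces ↔ ∃ t ∈ I.StrL, t.image (real I.C.vtxL) = τ :=
  I.exists_QL.choose_spec.1 τ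

/-- Auxiliary (`QK_hull`). [folklore] -/
theorem QK_hull {t : Finset (Fin I.C.N → ℝ)} (ht : t ∈ I.StrK) :
    convexHull ℝ ((t.image (real I.C.vtxK) : Finset (𝔼 n)) : Set (𝔼 n)) =
      real I.C.vtxK '' convexHull ℝ (t : Set (Fin I.C.N → ℝ)) := I.exists_QK.choose_spec.2 t ht

/-- Auxiliary (`QL_hull`). [folklore] -/
theorem QL_hull {t : Finset (Fin I.C.N → ℝ)} (ht : t ∈ I.StrL) :
    convexHull ℝ ((t.image (real I.C.vtxL) : Finset (𝔼 n)) : Set (𝔼 n)) =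
      real I.C.vtxL '' convexHull ℝ (t : Set (Fin I.C.N → ℝ)) := I.exists_QL.choose_spec.2 t ht

/-- Auxiliary (`QK_finite`). [folklore] -/
theorem QK_finite : I.QK.faces.Finite := by
  have : I.QK.faces = (fun t => t.image (real I.C.vtxK)) '' I.StrK := by
    ext τ; rw [QK_faces, Set.mem_image]
  rw [this]; exact (I.SK.P_finite.subset fun _ h => h.1).image _

/-- Auxiliary (`QL_finite`). [folklore] -/
theorem QL_finite : I.QL.faces.Finite := by
  have : I.QL.faces = (fun t => t.image (real I.C.vtxL)) '' I.StrL := by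
    ext τ; rw [QL_faces, Set.mem_image]
  rw [this]; exact (I.SL.P_finite.subset fun _ h => h.1).image _

/-- Points of `QK.space` come from straight simplices. [folklore] -/
theorem exists_of_mem_QK {y : 𝔼 n} (hy : y ∈ I.QK.space) :
    ∃ t ∈ I.StrK, ∃ x ∈ convexHull ℝ (t : Set (Fin I.C.N → ℝ)), real I.C.vtxK x = y := by
  obtain ⟨τ, hτ, hyτ⟩ := Geometry.SimplicialComplex.mem_space_iff.1 hy
  obtain ⟨t, ht, rfl⟩ := I.QK_faces.1 hτ
  rw [I.QK_hull ht] at hyτ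
  obtain ⟨x, hx, rfl⟩ := hyτ
  exact ⟨t, ht, x, hx, rfl⟩

/-- Points of `QL.space` come from straight simplices. [folklore] -/
theorem exists_of_mem_QL {y : 𝔼 n} (hy : y ∈ I.QL.space) :
    ∃ t ∈ I.StrL, ∃ x ∈ convexHull ℝ (t : Set (Fin I.C.N → ℝ)), real I.C.vtxL x = y := by
  obtain ⟨τ, hτ, hyτ⟩ := Geometry.SimplicialComplex.mem_space_iff.1 hy
  obtain ⟨t, ht, rfl⟩ := I.QL_faces.1 hτ
  rw [I.QL_hull ht] at hyτ
  obtain ⟨x, hx, rfl⟩ := hyτ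
  exact ⟨t, ht, x, hx, rfl⟩

/-- `QK.space ⊆ K.space`. [folklore] -/
theorem QK_space_subset : I.QK.space ⊆ I.T.K.space := fun y hy => by
  obtain ⟨t, ht, x, hx, rfl⟩ := I.exists_of_mem_QK hy
  rw [← I.C.realK_space]
  exact ⟨x, I.SK.P_space ▸ I.SK.P.convexHull_subset_space ht.1 hx, rfl⟩

/-- `QL.space ⊆ L.space`. [folklore] -/
theorem QL_space_subset : I.QL.space ⊆ I.T.L.space := fun y hy => by
  obtain ⟨t, ht, x, hx, rfl⟩ := I.exists_of_mem_QL hy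
  rw [← I.C.realL_space]
  exact ⟨x, I.SL.P_space ▸ I.SL.P.convexHull_subset_space ht.1 hx, rfl⟩

/-- On `QK.space`, `F' ∘ e₁.symm` maps into `ψ.source`. [folklore] -/
theorem F'_mem_source_of_mem_QK {y : 𝔼 n} (hy : y ∈ I.QK.space) : I.F' (I.P.e₁.symm y) ∈ I.P.ψ.source := by
  obtain ⟨t, ht, x, hx, rfl⟩ := I.exists_of_mem_QK hy
  exact (I.straightK ht hx).1

/-- On `QL.space`, `G' ∘ e₂.symm` maps into `ψ.source`. [folklore] -/
theorem G'_mem_source_of_mem_QL {y : 𝔼 n} (hy : y ∈ I.QL.space) : I.G' (I.P.e₂.symm y) ∈ I.P.ψ.source := by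
  obtain ⟨t, ht, x, hx, rfl⟩ := I.exists_of_mem_QL hy
  exact (I.straightL ht hx).1

/-- `βK` is affine on the simplices of `QK`. [folklore] -/
theorem affModel_βK : ∀ τ ∈ I.QK.faces, AffModel I.βK τ := by
  intro τ hτ
  obtain ⟨t, ht, rfl⟩ := I.QK_faces.1 hτ
  have hinj : InjOn (real I.C.vtxK).toAffineMap (convexHull ℝ (t : Set (Fin I.C.N → ℝ))) :=
    I.C.injOn_realK.mono (I.SK.P_space ▸ I.SK.P.convexHull_subset_space ht.1)
  obtain ⟨B, hB⟩ := exists_affine_leftInv (real I.C.vtxK).toAffineMap hinj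
  refine ⟨⟨(I.SK.A t ht.1).comp B, fun y hy => ?_⟩⟩
  rw [I.QK_hull ht] at hy
  obtain ⟨x, hx, rfl⟩ := hy
  rw [(I.straightK ht hx).2, AffineMap.comp_apply]
  congr 1
  exact (hB x hx).symm

/-- `βL` is affine on the simplices of `QL`. [folklore] -/
theorem affModel_βL : ∀ τ ∈ I.QL.faces, AffModel I.βL τ := by
  intro τ hτ
  obtain ⟨t, ht, rfl⟩ := I.QL_faces.1 hτ
  have hinj : InjOn (real I.C.vtxL).toAffineMap (convexHull ℝ (t : Set (Fin I.C.N → ℝ))) :=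
    I.C.injOn_realL.mono (I.SL.P_space ▸ I.SL.P.convexHull_subset_space ht.1)
  obtain ⟨B, hB⟩ := exists_affine_leftInv (real I.C.vtxL).toAffineMap hinj
  refine ⟨⟨(I.SL.A t ht.1).comp B, fun y hy => ?_⟩⟩
  rw [I.QL_hull ht] at hy
  obtain ⟨x, hx, rfl⟩ := hy
  rw [(I.straightL ht hx).2, AffineMap.comp_apply]
  congr 1
  exact (hB x hx).symm

/-- `βK` is injective on `QK.space`. [folklore] -/
theorem injOn_βK : InjOn I.βK I.QK.space := by
  intro y hy y' hy' h
  rw [βK_apply, βK_apply] at h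
  have h1 := I.P.ψ.injOn (I.F'_mem_source_of_mem_QK hy) (I.F'_mem_source_of_mem_QK hy') h
  have h2 : I.P.e₁.symm y = I.P.e₁.symm y' := I.F'.injective h1
  exact I.P.e₁.symm.injOn (by rw [I.P.e₁.symm_source]; exact (I.T.hKU (I.QK_space_subset hy)).1)
    (by rw [I.P.e₁.symm_source]; exact (I.T.hKU (I.QK_space_subset hy')).1) h2

/-- `βL` is injective on `QL.space`. [folklore] -/
theorem injOn_βL : InjOn I.βL I.QL.space := by
  intro y hy y' hy' h
  rw [βL_apply, βL_apply] at h
  have h1 := I.P.ψ.injOn (I.G'_mem_source_of_mem_QL hy) (I.G'_mem_source_of_mem_QL hy') h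
  have h2 : I.P.e₂.symm y = I.P.e₂.symm y' := I.G'.injective h1
  exact I.P.e₂.symm.injOn (by rw [I.P.e₂.symm_source]; exact (I.T.hLU (I.QL_space_subset hy)).1)
    (by rw [I.P.e₂.symm_source]; exact (I.T.hLU (I.QL_space_subset hy')).1) h2

/-- **Interior points of the first sheet mapped by `F` near the new ball lie in `QK.space`.**
[folklore] -/
theorem mem_QK_space {y : 𝔼 n} (hy : y ∈ I.T.K.space) (hs : I.F (I.P.e₁.symm y) ∈ I.P.ψ.source)
    (hb : I.P.ψ (I.F (I.P.e₁.symm y)) ∈ I.P.B 2) : y ∈ I.QK.space := by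
  rw [← I.C.realK_space] at hy
  obtain ⟨x, hx, rfl⟩ := hy
  have hxP : x ∈ I.SK.P.space := by rw [I.SK.P_space]; exact hx
  obtain ⟨t, ht, hxt⟩ := Geometry.SimplicialComplex.mem_space_iff.1 hxP
  have hxz : x ∈ zone I.IK.K I.IK.f I.IK.e I.IK.R₁ :=
    (mem_zone_iff (K := I.C.PK) (f := I.C.fK) (e := I.P.ψ) (I.P.B_subset_target 2)).2 ⟨hx, hs, hb⟩
  have hstr : t ∈ I.StrK := ⟨ht, I.SK.subset_zone₂_of_meets₁ ht ⟨x, hxt, hxz⟩⟩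
  refine Geometry.SimplicialComplex.mem_space_iff.2 ⟨t.image (real I.C.vtxK), I.QK_faces.2 ⟨t, hstr, rfl⟩, ?_⟩
  rw [I.QK_hull hstr]; exact ⟨x, hxt, rfl⟩

/-- The same for the second sheet. [folklore] -/
theorem mem_QL_space {y : 𝔼 n} (hy : y ∈ I.T.L.space) (hs : I.G (I.P.e₂.symm y) ∈ I.P.ψ.source)
    (hb : I.P.ψ (I.G (I.P.e₂.symm y)) ∈ I.P.B 2) : y ∈ I.QL.space := by
  rw [← I.C.realL_space] at hy
  obtain ⟨x, hx, rfl⟩ := hy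
  have hxP : x ∈ I.SL.P.space := by rw [I.SL.P_space]; exact hx
  obtain ⟨t, ht, hxt⟩ := Geometry.SimplicialComplex.mem_space_iff.1 hxP
  have hxz : x ∈ zone I.IL.K I.IL.f I.IL.e I.IL.R₁ :=
    (mem_zone_iff (K := I.C.PL) (f := I.C.fL) (e := I.P.ψ) (I.P.B_subset_target 2)).2 ⟨hx, hs, hb⟩
  have hstr : t ∈ I.StrL := ⟨ht, I.SL.subset_zone₂_of_meets₁ ht ⟨x, hxt, hxz⟩⟩
  refine Geometry.SimplicialComplex.mem_space_iff.2 ⟨t.image (real I.C.vtxL), I.QL_faces.2 ⟨t, hstr, rfl⟩, ?_⟩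
  rw [I.QL_hull hstr]; exact ⟨x, hxt, rfl⟩

/-- The open set of `e₁`-coordinates near the new ball lies in the interior of `QK.space`.
[folklore] -/
theorem mem_interior_QK {y : 𝔼 n} (hy : y ∈ interior I.T.K.space)
    (hs : I.F (I.P.e₁.symm y) ∈ I.P.ψ.source) (hb : I.P.ψ (I.F (I.P.e₁.symm y)) ∈ ball I.P.z (I.P.ρ 2)) :
    y ∈ interior I.QK.space := by
  set O : Set (𝔼 n) := interior I.T.K.space ∩ {y' | y' ∈ I.P.e₁.target ∧ I.F (I.P.e₁.symm y') ∈ I.P.ψ.source ∧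
    I.P.ψ (I.F (I.P.e₁.symm y')) ∈ ball I.P.z (I.P.ρ 2)} with hO
  have hcont : ContinuousOn (fun y' => I.F (I.P.e₁.symm y')) I.P.e₁.target :=
    I.F.continuous.comp_continuousOn I.P.e₁.continuousOn_symm
  have hO₁ : IsOpen {y' | y' ∈ I.P.e₁.target ∧ I.F (I.P.e₁.symm y') ∈ I.P.ψ.source ∧
      I.P.ψ (I.F (I.P.e₁.symm y')) ∈ ball I.P.z (I.P.ρ 2)} := by
    have h1 : IsOpen (I.P.e₁.target ∩ (fun y' => I.F (I.P.e₁.symm y')) ⁻¹' I.P.ψ.source) :=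
      hcont.isOpen_inter_preimage I.P.e₁.open_target I.P.ψ.open_source
    have hcont2 : ContinuousOn (fun y' => I.P.ψ (I.F (I.P.e₁.symm y')))
        (I.P.e₁.target ∩ (fun y' => I.F (I.P.e₁.symm y')) ⁻¹' I.P.ψ.source) :=
      I.P.ψ.continuousOn.comp (hcont.mono inter_subset_left) fun y' hy' => hy'.2
    have h2 := hcont2.isOpen_inter_preimage h1 (isOpen_ball (x := I.P.z) (ε := I.P.ρ 2))
    convert h2 using 1
    ext y'; simp only [mem_setOf_eq, mem_inter_iff, mem_preimage]; tauto
  have hOo : IsOpen O := isOpen_interior.inter hO₁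
  have hOQ : O ⊆ I.QK.space := fun y' hy' =>
    I.mem_QK_space (interior_subset hy'.1) hy'.2.2.1 (ball_subset_closedBall hy'.2.2.2)
  exact interior_maximal hOQ hOo ⟨hy, (I.T.hKU (interior_subset hy)).1, hs, hb⟩

/-- The same for the second sheet. [folklore] -/
theorem mem_interior_QL {y : 𝔼 n} (hy : y ∈ interior I.T.L.space)
    (hs : I.G (I.P.e₂.symm y) ∈ I.P.ψ.source) (hb : I.P.ψ (I.G (I.P.e₂.symm y)) ∈ ball I.P.z (I.P.ρ 2)) :
    y ∈ interior I.QL.space := by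
  set O : Set (𝔼 n) := interior I.T.L.space ∩ {y' | y' ∈ I.P.e₂.target ∧ I.G (I.P.e₂.symm y') ∈ I.P.ψ.source ∧
    I.P.ψ (I.G (I.P.e₂.symm y')) ∈ ball I.P.z (I.P.ρ 2)} with hO
  have hcont : ContinuousOn (fun y' => I.G (I.P.e₂.symm y')) I.P.e₂.target :=
    I.G.continuous.comp_continuousOn I.P.e₂.continuousOn_symm
  have hO₁ : IsOpen {y' | y' ∈ I.P.e₂.target ∧ I.G (I.P.e₂.symm y') ∈ I.P.ψ.source ∧
      I.P.ψ (I.G (I.P.e₂.symm y')) ∈ ball I.P.z (I.P.ρ 2)} := by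
    have h1 : IsOpen (I.P.e₂.target ∩ (fun y' => I.G (I.P.e₂.symm y')) ⁻¹' I.P.ψ.source) :=
      hcont.isOpen_inter_preimage I.P.e₂.open_target I.P.ψ.open_source
    have hcont2 : ContinuousOn (fun y' => I.P.ψ (I.G (I.P.e₂.symm y')))
        (I.P.e₂.target ∩ (fun y' => I.G (I.P.e₂.symm y')) ⁻¹' I.P.ψ.source) :=
      I.P.ψ.continuousOn.comp (hcont.mono inter_subset_left) fun y' hy' => hy'.2
    have h2 := hcont2.isOpen_inter_preimage h1 (isOpen_ball (x := I.P.z) (ε := I.P.ρ 2))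
    convert h2 using 1
    ext y'; simp only [mem_setOf_eq, mem_inter_iff, mem_preimage]; tauto
  have hOo : IsOpen O := isOpen_interior.inter hO₁
  have hOQ : O ⊆ I.QL.space := fun y' hy' =>
    I.mem_QL_space (interior_subset hy'.1) hy'.2.2.1 (ball_subset_closedBall hy'.2.2.2)
  exact interior_maximal hOQ hOo ⟨hy, (I.T.hLU (interior_subset hy)).1, hs, hb⟩

/-- Displacement of `ΦK` on `MB 6`: `≤ η / 32`. [folklore] -/
theorem norm_ΦK_sub_le_eta {q : M} (hq : q ∈ I.P.MB 6) :
    I.ΦK q ∈ I.P.ψ.source ∧ ‖I.P.ψ (I.ΦK q) - I.P.ψ q‖ ≤ I.P.η / 32 := by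
  rw [ΦK_apply]
  obtain ⟨hs, hle⟩ := I.SK.norm_e_Ψ_sub_le (I.SK.prot_subset_V hq) (I.P.MB_subset_source 6 hq)
  exact ⟨hs, hle.trans I.SK.δ₀_le_eta⟩

/-- Displacement of `ΦL` on `MB 6`: `≤ η / 32`. [folklore] -/
theorem norm_ΦL_sub_le_eta {q : M} (hq : q ∈ I.P.MB 6) :
    I.ΦL q ∈ I.P.ψ.source ∧ ‖I.P.ψ (I.ΦL q) - I.P.ψ q‖ ≤ I.P.η / 32 := by
  rw [ΦL_apply]
  obtain ⟨hs, hle⟩ := I.SL.norm_e_Ψ_sub_le (I.SL.prot_subset_V hq) (I.P.MB_subset_source 6 hq)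
  exact ⟨hs, hle.trans I.SL.δ₀_le_eta⟩

/-- `ΦK.symm` preserves `MB 6`. [folklore] -/
theorem ΦK_symm_mem {q : M} (hq : q ∈ I.P.MB 6) : I.ΦK.symm q ∈ I.P.MB 6 := by
  have h := I.ΦK_image_MB (le_refl (6 : Fin 10))
  rw [← h] at hq
  obtain ⟨q₀, hq₀, rfl⟩ := hq
  rw [Homeomorph.symm_apply_apply]; exact hq₀

/-- `ΦL.symm` preserves `MB 6`. [folklore] -/
theorem ΦL_symm_mem {q : M} (hq : q ∈ I.P.MB 6) : I.ΦL.symm q ∈ I.P.MB 6 := by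
  have h := I.ΦL_image_MB (le_refl (6 : Fin 10))
  rw [← h] at hq
  obtain ⟨q₀, hq₀, rfl⟩ := hq
  rw [Homeomorph.symm_apply_apply]; exact hq₀

/-- The new ball `Nw = ψ.symm '' ball z (ρ 1)`. [folklore] -/
def Nw : Set M := I.P.ψ.symm '' ball I.P.z (I.P.ρ 1)

/-- Auxiliary (`isOpen_Nw`). [folklore] -/
theorem isOpen_Nw : IsOpen I.Nw :=
  I.P.ψ.symm.isOpen_image_of_subset_source isOpen_ball (by
    rw [I.P.ψ.symm_source]; exact ball_subset_closedBall.trans (I.P.B_subset_target 1))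

/-- Auxiliary (`Nw_subset_MB`). [folklore] -/
theorem Nw_subset_MB : I.Nw ⊆ I.P.MB 1 := image_mono ball_subset_closedBall

/-- Auxiliary (`mem_Nw_iff`). [folklore] -/
theorem mem_Nw_iff {q : M} : q ∈ I.Nw ↔ q ∈ I.P.ψ.source ∧ I.P.ψ q ∈ ball I.P.z (I.P.ρ 1) := by
  constructor
  · rintro ⟨w, hw, rfl⟩
    have hwt : w ∈ I.P.ψ.target := I.P.B_subset_target 1 (ball_subset_closedBall hw)
    exact ⟨I.P.ψ.map_target hwt, by rw [I.P.ψ.right_inv hwt]; exact hw⟩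
  · rintro ⟨hq, hqB⟩
    exact ⟨I.P.ψ q, hqB, I.P.ψ.left_inv hq⟩

/-- **Preimages of the new ball under `F'`**: for `F' p ∈ Nw`, `F p ∈ MB 6`, `ψ (F p)` lies in the
ball of radius `ρ 2`, and `e₁ p ∈ QK.space` with `βK (e₁ p) = ψ (F' p)`. [folklore] -/
theorem preimage_Nw_K {p : M} (hp : I.F' p ∈ I.Nw) :
    I.F p ∈ I.P.MB 6 ∧ I.P.ψ (I.F p) ∈ ball I.P.z (I.P.ρ 2) ∧ p ∈ I.P.e₁.source ∧
      I.P.e₁ p ∈ interior I.QK.space ∧ I.βK (I.P.e₁ p) = I.P.ψ (I.F' p) := by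
  have hq6 : I.F' p ∈ I.P.MB 6 := I.P.MB_mono (by decide) (I.Nw_subset_MB hp)
  have hF6 : I.F p ∈ I.P.MB 6 := by
    have : I.F p = I.ΦK.symm (I.F' p) := by rw [F'_apply, Homeomorph.symm_apply_apply]
    rw [this]; exact I.ΦK_symm_mem hq6
  obtain ⟨-, hle⟩ := I.norm_ΦK_sub_le_eta hF6
  rw [← F'_apply] at hle
  have hball : I.P.ψ (I.F p) ∈ ball I.P.z (I.P.ρ 2) := by
    have h1 := (I.mem_Nw_iff.1 hp).2
    rw [mem_ball] at h1 ⊢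
    have h12 := I.P.hρ 1
    simp only [Fin.castSucc_one, Fin.succ_one_eq_two] at h12
    calc dist (I.P.ψ (I.F p)) I.P.z ≤ dist (I.P.ψ (I.F p)) (I.P.ψ (I.F' p)) + dist (I.P.ψ (I.F' p)) I.P.z :=
          dist_triangle _ _ _
      _ < I.P.η / 32 + I.P.ρ 1 := by
          rw [dist_eq_norm, ← norm_neg, neg_sub]; linarith [I.P.hη]
      _ ≤ I.P.ρ 2 := by linarith [I.P.hη]
  obtain ⟨hpe, hint⟩ := I.e₁_mem_interior (I.P.MB_mono (by decide) hF6)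
  have hsrc : I.F p ∈ I.P.ψ.source := I.P.MB_subset_source 6 hF6
  refine ⟨hF6, hball, hpe, I.mem_interior_QK hint (by rw [I.P.e₁.left_inv hpe]; exact hsrc)
    (by rw [I.P.e₁.left_inv hpe]; exact hball), ?_⟩
  rw [βK_apply, I.P.e₁.left_inv hpe]

/-- The same for `G'` and the second sheet. [folklore] -/
theorem preimage_Nw_L {p : M} (hp : I.G' p ∈ I.Nw) :
    I.G p ∈ I.P.MB 6 ∧ I.P.ψ (I.G p) ∈ ball I.P.z (I.P.ρ 2) ∧ p ∈ I.P.e₂.source ∧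
      I.P.e₂ p ∈ interior I.QL.space ∧ I.βL (I.P.e₂ p) = I.P.ψ (I.G' p) := by
  have hq6 : I.G' p ∈ I.P.MB 6 := I.P.MB_mono (by decide) (I.Nw_subset_MB hp)
  have hG6 : I.G p ∈ I.P.MB 6 := by
    have : I.G p = I.ΦL.symm (I.G' p) := by rw [G'_apply, Homeomorph.symm_apply_apply]
    rw [this]; exact I.ΦL_symm_mem hq6
  obtain ⟨-, hle⟩ := I.norm_ΦL_sub_le_eta hG6
  rw [← G'_apply] at hle
  have hball : I.P.ψ (I.G p) ∈ ball I.P.z (I.P.ρ 2) := by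
    have h1 := (I.mem_Nw_iff.1 hp).2
    rw [mem_ball] at h1 ⊢
    have h12 := I.P.hρ 1
    simp only [Fin.castSucc_one, Fin.succ_one_eq_two] at h12
    calc dist (I.P.ψ (I.G p)) I.P.z ≤ dist (I.P.ψ (I.G p)) (I.P.ψ (I.G' p)) + dist (I.P.ψ (I.G' p)) I.P.z :=
          dist_triangle _ _ _
      _ < I.P.η / 32 + I.P.ρ 1 := by
          rw [dist_eq_norm, ← norm_neg, neg_sub]; linarith [I.P.hη]
      _ ≤ I.P.ρ 2 := by linarith [I.P.hη]
  obtain ⟨hpe, hint⟩ := I.e₂_mem_interior (I.P.MB_mono (by decide) hG6)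
  have hsrc : I.G p ∈ I.P.ψ.source := I.P.MB_subset_source 6 hG6
  refine ⟨hG6, hball, hpe, I.mem_interior_QL hint (by rw [I.P.e₂.left_inv hpe]; exact hsrc)
    (by rw [I.P.e₂.left_inv hpe]; exact hball), ?_⟩
  rw [βL_apply, I.P.e₂.left_inv hpe]

/-- **The new ball is covered by the straight image**: `ball z (ρ 1) ⊆ interior (βK '' QK.space)`.
[folklore] -/
theorem ball_subset_βK : ball I.P.z (I.P.ρ 1) ⊆ interior (I.βK '' I.QK.space) := by
  refine interior_maximal (fun w hw => ?_) isOpen_ball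
  have hq : I.P.ψ.symm w ∈ I.Nw := ⟨w, hw, rfl⟩
  set p := I.F'.symm (I.P.ψ.symm w) with hp
  have hp' : I.F' p ∈ I.Nw := by rw [hp, Homeomorph.apply_symm_apply]; exact hq
  obtain ⟨-, -, -, hint, hβ⟩ := I.preimage_Nw_K hp'
  refine ⟨I.P.e₁ p, interior_subset hint, ?_⟩
  rw [hβ, hp, Homeomorph.apply_symm_apply, I.P.ψ.right_inv (I.P.B_subset_target 1 (ball_subset_closedBall hw))]

/-- The same for the second sheet. [folklore] -/
theorem ball_subset_βL : ball I.P.z (I.P.ρ 1) ⊆ interior (I.βL '' I.QL.space) := by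
  refine interior_maximal (fun w hw => ?_) isOpen_ball
  have hq : I.P.ψ.symm w ∈ I.Nw := ⟨w, hw, rfl⟩
  set p := I.G'.symm (I.P.ψ.symm w) with hp
  have hp' : I.G' p ∈ I.Nw := by rw [hp, Homeomorph.apply_symm_apply]; exact hq
  obtain ⟨-, -, -, hint, hβ⟩ := I.preimage_Nw_L hp'
  refine ⟨I.P.e₂ p, interior_subset hint, ?_⟩
  rw [hβ, hp, Homeomorph.apply_symm_apply, I.P.ψ.right_inv (I.P.B_subset_target 1 (ball_subset_closedBall hw))]

/-! #### PL-ness over the new ball -/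

/-- The domain, in `e₂`-coordinates, on which `e₁ ∘ h' ∘ e₂.symm` is shown to be PL. [folklore] -/
def WcK : Set (𝔼 n) := interior I.QL.space ∩ I.βL ⁻¹' interior (I.βK '' I.QK.space)

/-- The domain, in `e₁`-coordinates, on which `e₂ ∘ h'.symm ∘ e₁.symm` is shown to be PL.
[folklore] -/
def WcL : Set (𝔼 n) := interior I.QK.space ∩ I.βK ⁻¹' interior (I.βL '' I.QL.space)

/-- Auxiliary (`isOpen_WcK`). [folklore] -/
theorem isOpen_WcK : IsOpen I.WcK :=
  (isPLOn_of_affine_pieces I.QL_finite I.affModel_βL).continuousOn.isOpen_inter_preimage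
    isOpen_interior isOpen_interior

/-- Auxiliary (`isOpen_WcL`). [folklore] -/
theorem isOpen_WcL : IsOpen I.WcL :=
  (isPLOn_of_affine_pieces I.QK_finite I.affModel_βK).continuousOn.isOpen_inter_preimage
    isOpen_interior isOpen_interior

/-- **`e₁ ∘ h' ∘ e₂.symm = βK⁻¹ ∘ βL` is PL on `WcK`.** [cite: Munkres1966, Thm 10.5] -/
theorem isPLOn_κ : IsPLOn n n (I.P.e₁ ∘ I.h' ∘ I.P.e₂.symm) I.WcK := by
  have hf := isPLOn_of_affine_pieces I.QL_finite I.affModel_βL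
  have hg := isPLOn_invFunOn_of_affine_pieces I.QK_finite I.affModel_βK I.injOn_βK
  have hc := IsPLOn.comp_holds hf hg isOpen_interior isOpen_interior I.isOpen_WcK
  refine hc.congr I.isOpen_WcK fun y hy => ?_
  have hyL : y ∈ I.QL.space := interior_subset hy.1
  have hβy : I.βL y ∈ I.βK '' I.QK.space := interior_subset hy.2
  obtain ⟨y₀, hy₀, hy₀eq⟩ := hβy
  have hmem : invFunOn I.βK I.QK.space (I.βL y) ∈ I.QK.space := invFunOn_mem ⟨y₀, hy₀, hy₀eq⟩
  have heq : I.βK (invFunOn I.βK I.QK.space (I.βL y)) = I.βL y := invFunOn_eq ⟨y₀, hy₀, hy₀eq⟩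
  set y₁ := invFunOn I.βK I.QK.space (I.βL y) with hy₁
  have hs₁ := I.F'_mem_source_of_mem_QK hmem
  have hs₂ := I.G'_mem_source_of_mem_QL hyL
  rw [βK_apply, βL_apply] at heq
  have h1 : I.F' (I.P.e₁.symm y₁) = I.G' (I.P.e₂.symm y) := I.P.ψ.injOn hs₁ hs₂ heq
  have h2 : I.P.e₁.symm y₁ = I.h' (I.P.e₂.symm y) := by
    show I.P.e₁.symm y₁ = I.F'.symm (I.G' (I.P.e₂.symm y))
    rw [← h1, Homeomorph.symm_apply_apply]
  show I.P.e₁ (I.h' (I.P.e₂.symm y)) = y₁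
  rw [← h2, I.P.e₁.right_inv (I.T.hKU (I.QK_space_subset hmem)).1]

/-- **`e₂ ∘ h'.symm ∘ e₁.symm = βL⁻¹ ∘ βK` is PL on `WcL`.** [cite: Munkres1966, Thm 10.5] -/
theorem isPLOn_κ' : IsPLOn n n (I.P.e₂ ∘ I.h'.symm ∘ I.P.e₁.symm) I.WcL := by
  have hf := isPLOn_of_affine_pieces I.QK_finite I.affModel_βK
  have hg := isPLOn_invFunOn_of_affine_pieces I.QL_finite I.affModel_βL I.injOn_βL
  have hc := IsPLOn.comp_holds hf hg isOpen_interior isOpen_interior I.isOpen_WcL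
  refine hc.congr I.isOpen_WcL fun y hy => ?_
  have hyK : y ∈ I.QK.space := interior_subset hy.1
  have hβy : I.βK y ∈ I.βL '' I.QL.space := interior_subset hy.2
  obtain ⟨y₀, hy₀, hy₀eq⟩ := hβy
  have hmem : invFunOn I.βL I.QL.space (I.βK y) ∈ I.QL.space := invFunOn_mem ⟨y₀, hy₀, hy₀eq⟩
  have heq : I.βL (invFunOn I.βL I.QL.space (I.βK y)) = I.βK y := invFunOn_eq ⟨y₀, hy₀, hy₀eq⟩
  set y₁ := invFunOn I.βL I.QL.space (I.βK y) with hy₁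
  have hs₁ := I.G'_mem_source_of_mem_QL hmem
  have hs₂ := I.F'_mem_source_of_mem_QK hyK
  rw [βK_apply, βL_apply] at heq
  have h1 : I.G' (I.P.e₂.symm y₁) = I.F' (I.P.e₁.symm y) := I.P.ψ.injOn hs₁ hs₂ heq
  have h2 : I.P.e₂.symm y₁ = I.h'.symm (I.P.e₁.symm y) := by
    show I.P.e₂.symm y₁ = I.G'.symm (I.F' (I.P.e₁.symm y))
    rw [← h1, Homeomorph.symm_apply_apply]
  show I.P.e₂ (I.h'.symm (I.P.e₁.symm y)) = y₁
  rw [← h2, I.P.e₂.right_inv (I.T.hLU (I.QL_space_subset hmem)).1]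

/-- Auxiliary (`WcK_subset_target`). [folklore] -/
theorem WcK_subset_target : I.WcK ⊆ I.P.e₂.target := fun _ hy =>
  (I.T.hLU (I.QL_space_subset (interior_subset hy.1))).1

/-- Auxiliary (`WcL_subset_target`). [folklore] -/
theorem WcL_subset_target : I.WcL ⊆ I.P.e₁.target := fun _ hy =>
  (I.T.hKU (I.QK_space_subset (interior_subset hy.1))).1

/-- Points mapped by `G'` into the new ball satisfy the chart criterion. [folklore] -/
theorem region_c {p : M} (hp : I.G' p ∈ I.Nw) :
    p ∈ I.P.e₂.source ∧ I.P.e₂ p ∈ I.WcK ∧ I.h' p ∈ I.P.e₁.source := by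
  obtain ⟨-, -, hpe, hint, hβ⟩ := I.preimage_Nw_L hp
  have hball : I.βL (I.P.e₂ p) ∈ ball I.P.z (I.P.ρ 1) := by rw [hβ]; exact (I.mem_Nw_iff.1 hp).2
  refine ⟨hpe, ⟨hint, I.ball_subset_βK hball⟩, ?_⟩
  have hp' : I.F' (I.h' p) ∈ I.Nw := by
    show I.F' (I.F'.symm (I.G' p)) ∈ I.Nw
    rw [Homeomorph.apply_symm_apply]; exact hp
  exact (I.preimage_Nw_K hp').2.2.1

/-- Points mapped by `F'` into the new ball satisfy the chart criterion (inverse direction).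
[folklore] -/
theorem region_c' {p : M} (hp : I.F' p ∈ I.Nw) :
    p ∈ I.P.e₁.source ∧ I.P.e₁ p ∈ I.WcL ∧ I.h'.symm p ∈ I.P.e₂.source := by
  obtain ⟨-, -, hpe, hint, hβ⟩ := I.preimage_Nw_K hp
  have hball : I.βK (I.P.e₁ p) ∈ ball I.P.z (I.P.ρ 1) := by rw [hβ]; exact (I.mem_Nw_iff.1 hp).2
  refine ⟨hpe, ⟨hint, I.ball_subset_βL hball⟩, ?_⟩
  have hp' : I.G' (I.h'.symm p) ∈ I.Nw := by
    show I.G' (I.G'.symm (I.F' p)) ∈ I.Nw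
    rw [Homeomorph.apply_symm_apply]; exact hp
  exact (I.preimage_Nw_L hp').2.2.1

/-! #### The PL conclusions of the stage -/

/-- **`h' = F'⁻¹ ∘ G'` is PL along `(c₂, c₁)` over `G'⁻¹' (Am ∪ Nw)`.** [cite: Munkres1966, Thm 10.5] -/
theorem plAlongOn_h' (h₁ : @IsPLManifold n hcomp haff M _ c₁) (h₂ : @IsPLManifold n hcomp haff M _ c₂) :
    PLAlongOn n c₂ c₁ I.h' (I.G' ⁻¹' (I.Am ∪ I.Nw)) := by
  -- region (a): far from the bends
  have hAo : IsOpen (I.G ⁻¹' I.A) := I.hA.preimage I.G.continuous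
  have h5o : IsOpen (I.G ⁻¹' (I.P.MB 5)ᶜ) := (I.P.isCompact_MB 5).isClosed.isOpen_compl.preimage I.G.continuous
  have ha : PLAlongOn n c₂ c₁ I.h' (I.G ⁻¹' I.A ∩ I.G ⁻¹' (I.P.MB 5)ᶜ) :=
    I.hPL.congr_inter hAo h5o fun p hp => I.h'_eq_h_far hp
  -- region (b): where the two comparison maps agree
  have hb : PLAlongOn n c₂ c₁ I.h' (I.G ⁻¹' I.A ∩ I.G ⁻¹' I.Ob) :=
    I.hPL.congr_inter hAo (I.isOpen_Ob.preimage I.G.continuous) fun p hp => I.h'_eq_h_Ob hp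
  -- region (c): the new ball
  have hc : PLAlongOn n c₂ c₁ I.h' (I.G' ⁻¹' I.Nw) :=
    plAlongOn_of_chart hcomp haff h₂ h₁ I.P.he₂ I.P.he₁ I.isOpen_WcK I.isPLOn_κ I.WcK_subset_target
      (I.isOpen_Nw.preimage I.G'.continuous) fun p hp => I.region_c hp
  refine (plAlongOn_union (plAlongOn_union ha hb) hc).anti' ((I.hAm.union I.isOpen_Nw).preimage I.G'.continuous)
    fun p hp => ?_
  rcases hp with hp | hp
  · by_cases h5 : I.G p ∈ I.P.MB 5
    · have hZ : I.G p ∈ I.Zc := I.mem_Zc_of_ΦL_mem h5 hp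
      exact Or.inl (Or.inr ⟨I.hAclA hZ.2, I.Zc_subset_Ob hZ⟩)
    · refine Or.inl (Or.inl ⟨?_, h5⟩)
      show I.G p ∈ I.A
      rw [← I.G'_eq h5]; exact I.hAclA (I.hAmAcl hp)
  · exact Or.inr hp

/-- **`h'.symm = G'⁻¹ ∘ F'` is PL along `(c₁, c₂)` over `F'⁻¹' (Am ∪ Nw)`.** [cite: Munkres1966, Thm 10.5] -/
theorem plAlongOn_h'_symm (h₁ : @IsPLManifold n hcomp haff M _ c₁) (h₂ : @IsPLManifold n hcomp haff M _ c₂) :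
    PLAlongOn n c₁ c₂ I.h'.symm (I.F' ⁻¹' (I.Am ∪ I.Nw)) := by
  have hAo : IsOpen (I.F ⁻¹' I.A) := I.hA.preimage I.F.continuous
  have h5o : IsOpen (I.F ⁻¹' (I.P.MB 5)ᶜ) := (I.P.isCompact_MB 5).isClosed.isOpen_compl.preimage I.F.continuous
  have ha : PLAlongOn n c₁ c₂ I.h'.symm (I.F ⁻¹' I.A ∩ I.F ⁻¹' (I.P.MB 5)ᶜ) :=
    I.hPL'.congr_inter hAo h5o fun p hp => I.h'_symm_eq_far hp
  have hb : PLAlongOn n c₁ c₂ I.h'.symm (I.F ⁻¹' I.A ∩ I.F ⁻¹' I.Ob') :=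
    I.hPL'.congr_inter hAo (I.isOpen_Ob'.preimage I.F.continuous) fun p hp => I.h'_symm_eq_Ob' hp
  have hc : PLAlongOn n c₁ c₂ I.h'.symm (I.F' ⁻¹' I.Nw) :=
    plAlongOn_of_chart hcomp haff h₁ h₂ I.P.he₁ I.P.he₂ I.isOpen_WcL I.isPLOn_κ' I.WcL_subset_target
      (I.isOpen_Nw.preimage I.F'.continuous) fun p hp => I.region_c' hp
  refine (plAlongOn_union (plAlongOn_union ha hb) hc).anti' ((I.hAm.union I.isOpen_Nw).preimage I.F'.continuous)
    fun p hp => ?_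
  rcases hp with hp | hp
  · by_cases h5 : I.F p ∈ I.P.MB 5
    · have hZ : I.F p ∈ I.Zc := I.mem_Zc_of_ΦK_mem h5 hp
      exact Or.inl (Or.inr ⟨I.hAclA hZ.2, I.Zc_subset_Ob' hZ⟩)
    · refine Or.inl (Or.inl ⟨?_, h5⟩)
      show I.F p ∈ I.A
      rw [← I.F'_eq h5]; exact I.hAclA (I.hAmAcl hp)
  · exact Or.inr hp

end UStageIn

end Stage

end Literature.Topology.FourManifolds
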